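import Literature.Barriers.Parity.SiegelZeroDichotomyPairHLProp71ii
import HarnessLib

/-!
# Tao–Teräväinen 2022, Proposition 7.2 at `k = 2`, `ℓ = 0`: the cross correlation
# `∑_{n ≤ x} Λ♭_Siegel(n+h₁) (χ∗Φ_t)(n+h₂) ν(n+h₂)` from Proposition 7.1 (i)

Topic `Literature/Barriers/Parity`, sub-namespace `TaoTeravainen`; a file of the proof DAG of
`Literature.Barriers.Parity.TaoTeravainen2021_prop72_81_pair` (T. Tao, J. Teräväinen, *The
Hardy–Littlewood–Chowla conjecture in the presence of a Siegel zero*, J. London Math. Soc. (2) 106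
(2022), arXiv:2109.06291), proof of Proposition 7.2 ("Replacing `Λ_Siegel` with a Type I
approximant. Assume `k ≤ 2`."), the bounds (7.11)–(7.12) at `k = 2`, `ℓ = 0`. The source: "From (7.2),
(7.3) and the pigeonhole principle we can bound both left-hand sides (up to negligible errors) by
`≪_ε x^{O(ε)} |𝔼_{n ≤ x} Λ♭_Siegel(n+h₁) (∑_{d₂ ∣ n+h₂} χ(d₂) Φ_t((n+h₂)/d₂)) ν(n+h₂)|` for some
`1 ≪ t ≪ x` … We now use a version of the Dirichlet hyperbola method. First suppose that `t ≥ √x`,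
then the summand vanishes unless `d₂ ≪ √x`. Expanding out using (7.8) … using summation by parts to
deal with the slowly varying function `Φ_t((n+h₂)/d₂)`, we can again bound this expression by (7.15)
[Proposition 7.1] … Finally, suppose that `t < √x`. Now we make the change of variables
`d₂* := (n+h₂)/d₂` … using `d₂*` in place of `d₂`, and the `q_χ`-periodic function `χ` in place of
`Φ_t`". Everything here is PROVED, for the sum at ONE `t = e^u` (the `t`-integration giving
(7.11)–(7.12) is the sequel):

* tools: Abel summation on an interval (`sum_Icc_mul_eq_abel`, `abs_sum_Icc_mul_le_of_partial`), the
  Chinese remainder theorem for `{L ∣ N, M ∣ N + Δ}` (`dvd_and_dvd_add_iff_modEq`) with the bound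
  `(N₀, [L, M]) ≤ L |Δ|` on the residue (`gcd_le_of_dvd_of_dvd_add`), the `q`-periodic weight
  `k ↦ χ(c₀ + s k)` (`charLine`);
* for a sequence `F` with a level-of-distribution bound of the shape of Proposition 7.1 (i)
  (hypothesis `hF` below: `|∑_{N ∈ [N₁,N₂], N ≡ a (Q₁)} F(N) f((N-a)/Q₁)| ≤ Y ((a,Q₁)+1)²/Q₁` for
  `Q₁ ≤ Q_max`, `1`-bounded `q`-periodic `f`), the two hyperbola halves `crossA` (outer variable
  `d₂ = a`, smooth weight `φ(log((n+h₂)/a) - u)`, Abel summation) and `crossB` (outer variable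
  `d₂* = b`, weight `χ((n+h₂)/b)`), and the bound for
  `T(L₁,L₂,u) = ∑_{n ≤ x} F(n+h₁) 1_{L₁∣n+h₁} 1_{L₂∣n+h₂} K_u(n+h₂)` (`abs_crossT_le`), where
  `K_u = χ∗Φ_{e^u}` is `hypK` of `…TypeIModel.lean`;
* the expansion of the two sieve weights `ν = (∑_{e ∈ E} λ_e 1_{e∣·})²` ((7.8): `crossS_eq_sum`;
  this file expands both weights and inserts Proposition 7.1 (i) directly, rather than going
  through Proposition 7.1 (ii) = `prop71_ii` of `…Prop71ii.lean`, whose `card_sieveRange_le` is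
  reused) and
  **`abs_flatCross_le`**: for `x ≥ x₀`, `q ≤ x^{1/20}`, `1 < R ≤ x^c` and every `u`,
  `|∑_{n ≤ x} Λ♭_Siegel(n+h₁) K_u(n+h₂) ν(n+h₂)| ≤ C x^{1-c}`, `Λ♭_Siegel = (χ∗log)♭ ν` taken with
  `X = log x`, `U₀ = log(Dq²)`, `D = x^{ε₀/20}` as in `prop71_i`.
  [cite: TaoTeravainen2021, Proposition 7.2 (proof, (7.11)–(7.12) and (7.16)), Proposition 7.1 (i)]
-/

noncomputable section

open Finset Real MeasureTheory
open scoped ContDiff Topology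

namespace Literature.Barriers.Parity

namespace TaoTeravainen

variable {q : ℕ}

/-! ### Abel summation on an interval -/

/-- **Abel summation**: `∑_{N=N₁}^{N₂} F(N) w(N) = S(N₂) w(N₂) - ∑_{N=N₁}^{N₂-1} S(N) (w(N+1) - w(N))`,
`S(N) = ∑_{M=N₁}^{N} F(M)`. [folklore] -/
theorem sum_Icc_mul_eq_abel (F w : ℕ → ℝ) (N₁ : ℕ) :
    ∀ N₂ : ℕ, N₁ ≤ N₂ + 1 →
      ∑ N ∈ Icc N₁ N₂, F N * w N =
        (∑ N ∈ Icc N₁ N₂, F N) * w N₂ -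
          ∑ N ∈ Ico N₁ N₂, (∑ M ∈ Icc N₁ N, F M) * (w (N + 1) - w N) := by
  intro N₂
  induction N₂ with
  | zero =>
    intro h
    rcases Nat.le_one_iff_eq_zero_or_eq_one.mp h with rfl | rfl
    · simp
    · simp
  | succ n ih =>
    intro h
    rcases Nat.lt_or_ge (n + 1) N₁ with hlt | hle
    · -- everything is empty
      have h1 : Icc N₁ (n + 1) = ∅ := Finset.Icc_eq_empty (by omega)
      have h2 : Ico N₁ (n + 1) = ∅ := Finset.Ico_eq_empty (by omega)
      simp [h1, h2]
    · rw [Finset.sum_Icc_succ_top hle, Finset.sum_Icc_succ_top hle]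
      rcases Nat.lt_or_ge n N₁ with hlt' | hle'
      · -- `N₁ = n + 1`: one term
        have hN : N₁ = n + 1 := by omega
        subst hN
        simp
      · rw [ih (by omega), Finset.sum_Ico_succ_top hle']
        ring

/-- **The Abel bound**: if all partial sums `|∑_{M=N₁}^{N} F(M)|` (`N₁ ≤ N ≤ N₂`) are `≤ S`,
`|w(N₂)| ≤ B` and `∑_{N=N₁}^{N₂-1} |w(N+1) - w(N)| ≤ V`, then `|∑_{N=N₁}^{N₂} F(N) w(N)| ≤ S (B + V)`.
[folklore] -/
theorem abs_sum_Icc_mul_le_of_partial (F w : ℕ → ℝ) {N₁ N₂ : ℕ} {S B V : ℝ} (hS : 0 ≤ S)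
    (hpartial : ∀ N ∈ Icc N₁ N₂, |∑ M ∈ Icc N₁ N, F M| ≤ S) (hB : |w N₂| ≤ B)
    (hV : ∑ N ∈ Ico N₁ N₂, |w (N + 1) - w N| ≤ V) :
    |∑ N ∈ Icc N₁ N₂, F N * w N| ≤ S * (B + V) := by
  have hB0 : 0 ≤ B := (abs_nonneg _).trans hB
  have hV0 : 0 ≤ V := le_trans (Finset.sum_nonneg fun _ _ => abs_nonneg _) hV
  rcases Nat.lt_or_ge (N₂ + 1) N₁ with hlt | hle
  · rw [Finset.Icc_eq_empty (by omega), Finset.sum_empty, abs_zero]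
    positivity
  rw [sum_Icc_mul_eq_abel F w N₁ N₂ hle]
  have h1 : |(∑ N ∈ Icc N₁ N₂, F N) * w N₂| ≤ S * B := by
    rw [abs_mul]
    rcases Nat.lt_or_ge N₂ N₁ with h | h
    · rw [Finset.Icc_eq_empty (by omega), Finset.sum_empty, abs_zero, zero_mul]
      positivity
    · exact mul_le_mul (hpartial N₂ (mem_Icc.mpr ⟨h, le_rfl⟩)) hB (abs_nonneg _) hS
  have h2 : |∑ N ∈ Ico N₁ N₂, (∑ M ∈ Icc N₁ N, F M) * (w (N + 1) - w N)| ≤ S * V := by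
    calc |∑ N ∈ Ico N₁ N₂, (∑ M ∈ Icc N₁ N, F M) * (w (N + 1) - w N)|
        ≤ ∑ N ∈ Ico N₁ N₂, |(∑ M ∈ Icc N₁ N, F M) * (w (N + 1) - w N)| := abs_sum_le_sum_abs _ _
      _ ≤ ∑ N ∈ Ico N₁ N₂, S * |w (N + 1) - w N| := by
          refine sum_le_sum fun N hN => ?_
          rw [abs_mul]
          rw [mem_Ico] at hN
          exact mul_le_mul_of_nonneg_right (hpartial N (mem_Icc.mpr ⟨hN.1, hN.2.le⟩)) (abs_nonneg _)
      _ = S * ∑ N ∈ Ico N₁ N₂, |w (N + 1) - w N| := by rw [mul_sum]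
      _ ≤ S * V := mul_le_mul_of_nonneg_left hV hS
  calc |(∑ N ∈ Icc N₁ N₂, F N) * w N₂ - ∑ N ∈ Ico N₁ N₂, (∑ M ∈ Icc N₁ N, F M) * (w (N + 1) - w N)|
      ≤ |(∑ N ∈ Icc N₁ N₂, F N) * w N₂| +
          |∑ N ∈ Ico N₁ N₂, (∑ M ∈ Icc N₁ N, F M) * (w (N + 1) - w N)| := abs_sub _ _
    _ ≤ S * B + S * V := add_le_add h1 h2
    _ = S * (B + V) := by ring

/-- The variation of `N ↦ φ(log(N + δ) - c)` along `[N₁, N₂]` is at most `sup|φ'| · log((N₂+δ)/(N₁+δ))`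
for `N₁ + δ > 0` (`φ` is `sup|φ'|`-Lipschitz and `log` is monotone: the sum telescopes).
[cite: TaoTeravainen2021, proof of Proposition 7.2 ("summation by parts to deal with the slowly varying
function `Φ_t((n+h₂)/d₂)`")] -/
theorem sum_abs_bump_log_sub_le {φ : ℝ → ℝ} (hφ : IsBump φ) {B₁ : ℝ} (hB₁ : ∀ u, |deriv φ u| ≤ B₁)
    {δ : ℝ} (c : ℝ) {N₁ N₂ : ℕ} (hN : N₁ ≤ N₂) (hδ : 0 < (N₁ : ℝ) + δ) :
    ∑ N ∈ Ico N₁ N₂, |φ (Real.log ((N : ℝ) + 1 + δ) - c) - φ (Real.log ((N : ℝ) + δ) - c)| ≤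
      B₁ * (Real.log ((N₂ : ℝ) + δ) - Real.log ((N₁ : ℝ) + δ)) := by
  have hB₁0 : 0 ≤ B₁ := (abs_nonneg _).trans (hB₁ 0)
  have hd : ∀ z ∈ (Set.univ : Set ℝ), DifferentiableAt ℝ φ z := fun z _ =>
    (hφ.contDiff.differentiable (by simp)).differentiableAt
  have hb : ∀ z ∈ (Set.univ : Set ℝ), ‖deriv φ z‖ ≤ B₁ := fun z _ => by
    rw [Real.norm_eq_abs]; exact hB₁ z
  have hlip : ∀ s t : ℝ, |φ s - φ t| ≤ B₁ * |s - t| := fun s t => by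
    have := Convex.norm_image_sub_le_of_norm_deriv_le hd hb convex_univ (Set.mem_univ t) (Set.mem_univ s)
    rwa [Real.norm_eq_abs, Real.norm_eq_abs] at this
  -- termwise Lipschitz bound, then telescope
  have hterm : ∀ N ∈ Ico N₁ N₂,
      |φ (Real.log ((N : ℝ) + 1 + δ) - c) - φ (Real.log ((N : ℝ) + δ) - c)| ≤
        B₁ * (Real.log ((N : ℝ) + 1 + δ) - Real.log ((N : ℝ) + δ)) := by
    intro N hN
    rw [mem_Ico] at hN
    have hN0 : 0 < (N : ℝ) + δ := by
      have : (N₁ : ℝ) ≤ N := by exact_mod_cast hN.1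
      linarith
    have hmono : Real.log ((N : ℝ) + δ) ≤ Real.log ((N : ℝ) + 1 + δ) :=
      Real.log_le_log hN0 (by linarith)
    calc |φ (Real.log ((N : ℝ) + 1 + δ) - c) - φ (Real.log ((N : ℝ) + δ) - c)|
        ≤ B₁ * |(Real.log ((N : ℝ) + 1 + δ) - c) - (Real.log ((N : ℝ) + δ) - c)| := hlip _ _
      _ = B₁ * (Real.log ((N : ℝ) + 1 + δ) - Real.log ((N : ℝ) + δ)) := by
          rw [show (Real.log ((N : ℝ) + 1 + δ) - c) - (Real.log ((N : ℝ) + δ) - c) =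
              Real.log ((N : ℝ) + 1 + δ) - Real.log ((N : ℝ) + δ) by ring, abs_of_nonneg (by linarith)]
  refine (sum_le_sum hterm).trans ?_
  rw [← mul_sum]
  refine mul_le_mul_of_nonneg_left (le_of_eq ?_) hB₁0
  -- telescoping sum of `g(N+1) - g(N)` with `g(N) = log(N + δ)`
  have htel : ∀ n : ℕ, N₁ ≤ n →
      ∑ N ∈ Ico N₁ n, (Real.log ((N : ℝ) + 1 + δ) - Real.log ((N : ℝ) + δ)) =
        Real.log ((n : ℝ) + δ) - Real.log ((N₁ : ℝ) + δ) := by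
    intro n hn
    induction n, hn using Nat.le_induction with
    | base => simp
    | succ m hm ih =>
      rw [Finset.sum_Ico_succ_top hm, ih]
      push_cast
      ring
  exact htel N₂ hN

/-! ### The Chinese remainder theorem for `{L ∣ N, M ∣ N + Δ}` -/

/-- `[L, M] ∣ z` iff `L ∣ z` and `M ∣ z` (integers, natural moduli). [folklore] -/
theorem natCast_lcm_dvd_iff (L M : ℕ) (z : ℤ) :
    ((Nat.lcm L M : ℕ) : ℤ) ∣ z ↔ (L : ℤ) ∣ z ∧ (M : ℤ) ∣ z := by
  rw [Int.natCast_dvd, Int.natCast_dvd, Int.natCast_dvd, Nat.lcm_dvd_iff]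

/-- **CRT for two shifted congruences** (Lemma 3.3 (ii) of the source in the form needed here): if
`N₀` solves `L ∣ N₀`, `M ∣ N₀ + Δ`, then `L ∣ N ∧ M ∣ N + Δ ↔ N ≡ N₀ (mod [L, M])`.
[cite: TaoTeravainen2021, Lemma 3.3 (ii)] -/
theorem dvd_and_dvd_add_iff_modEq {L M : ℕ} {Δ N₀ : ℤ} (h₁ : (L : ℤ) ∣ N₀) (h₂ : (M : ℤ) ∣ N₀ + Δ)
    (N : ℤ) : ((L : ℤ) ∣ N ∧ (M : ℤ) ∣ N + Δ) ↔ N ≡ N₀ [ZMOD (Nat.lcm L M : ℕ)] := by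
  rw [Int.modEq_iff_dvd, natCast_lcm_dvd_iff]
  constructor
  · rintro ⟨hL, hM⟩
    refine ⟨(Int.dvd_sub h₁ hL), ?_⟩
    have := Int.dvd_sub h₂ hM
    rwa [show N₀ + Δ - (N + Δ) = N₀ - N by ring] at this
  · rintro ⟨hL, hM⟩
    refine ⟨?_, ?_⟩
    · have := Int.dvd_sub h₁ hL
      rwa [show N₀ - (N₀ - N) = N by ring] at this
    · have := Int.dvd_sub h₂ hM
      rwa [show N₀ + Δ - (N₀ - N) = N + Δ by ring] at this

/-- **The residue has small common factor with the modulus**: if `L ∣ N₀`, `M ∣ N₀ + Δ`, `Δ ≠ 0`,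
`L ≥ 1`, then `(N₀, [L, M]) ≤ L |Δ|` (indeed `(N₀, LM) ∣ (N₀, L)(N₀, M)` and `(N₀, M) ∣ Δ`).
[cite: TaoTeravainen2021, proof of Proposition 7.2 ("restrict `n` to a single residue class `a (d)`
with `(a, d) ≪ 1`")] -/
theorem gcd_le_of_dvd_of_dvd_add {L M : ℕ} (hL : 1 ≤ L) {Δ N₀ : ℤ} (hΔ : Δ ≠ 0)
    (h₁ : (L : ℤ) ∣ N₀) (h₂ : (M : ℤ) ∣ N₀ + Δ) :
    Int.gcd N₀ (Nat.lcm L M : ℕ) ≤ L * Δ.natAbs := by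
  have _ := h₁
  set n₀ : ℕ := N₀.natAbs with hn₀
  have hg : Int.gcd N₀ (Nat.lcm L M : ℕ) = Nat.gcd n₀ (Nat.lcm L M) := by
    rw [Int.gcd, Int.natAbs_natCast]
  rw [hg]
  -- `(n₀, [L,M]) ∣ (n₀, LM) ∣ (n₀, L)(n₀, M)` and `(n₀, M) ∣ |Δ|`
  have h3 : Nat.gcd n₀ (Nat.lcm L M) ∣ Nat.gcd n₀ (L * M) :=
    Nat.gcd_dvd_gcd_of_dvd_right _ (Nat.lcm_dvd_mul L M)
  have h4 : Nat.gcd n₀ (L * M) ∣ Nat.gcd n₀ L * Nat.gcd n₀ M := gcd_mul_dvd_mul_gcd n₀ L M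
  have h5 : Nat.gcd n₀ M ∣ Δ.natAbs := by
    have hM : ((Nat.gcd n₀ M : ℕ) : ℤ) ∣ (M : ℤ) := by exact_mod_cast Nat.gcd_dvd_right n₀ M
    have hN : ((Nat.gcd n₀ M : ℕ) : ℤ) ∣ N₀ := by
      rw [Int.natCast_dvd]; exact Nat.gcd_dvd_left n₀ M
    have hΔ' : ((Nat.gcd n₀ M : ℕ) : ℤ) ∣ Δ := by
      have := Int.dvd_sub (hM.trans h₂) hN
      rwa [show N₀ + Δ - N₀ = Δ by ring] at this
    exact Int.natCast_dvd.mp hΔ'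
  have hpos : 0 < L * Δ.natAbs := Nat.mul_pos hL (Int.natAbs_pos.mpr hΔ)
  refine Nat.le_of_dvd hpos ((h3.trans h4).trans ?_)
  exact Nat.mul_dvd_mul (Nat.gcd_dvd_right n₀ L) h5

/-! ### The `q`-periodic weight `k ↦ χ(c₀ + s k)` -/

/-- `f(k) := Re χ(c₀ + s k)` — the character `χ((n+h₂)/d₂*)` as a function of the progression
index ("the `q_χ`-periodic function `χ` in place of `Φ_t`"). [cite: TaoTeravainen2021, proof of
Proposition 7.2 (the case `t < √x`)] -/
def charLine (χ : DirichletCharacter ℂ q) (c₀ : ℤ) (s : ℕ) (k : ℤ) : ℝ :=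
  (χ ((c₀ + s * k : ℤ) : ZMod q)).re

/-- `|f| ≤ 1`. [folklore] -/
theorem abs_charLine_le (χ : DirichletCharacter ℂ q) (c₀ : ℤ) (s : ℕ) (k : ℤ) :
    |charLine χ c₀ s k| ≤ 1 :=
  (Complex.abs_re_le_norm _).trans (χ.norm_le_one _)

/-- `f` is `q`-periodic. [folklore] -/
theorem charLine_add (χ : DirichletCharacter ℂ q) (c₀ : ℤ) (s : ℕ) (k : ℤ) :
    charLine χ c₀ s (k + q) = charLine χ c₀ s k := by
  unfold charLine
  congr 2
  push_cast
  rw [ZMod.natCast_self]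
  ring

/-- On the naturals, `f` recovers `realChar`: if `(m : ℤ) = c₀ + s k` then `Re χ(m) = f(k)`. [folklore] -/
theorem realChar_eq_charLine (χ : DirichletCharacter ℂ q) {c₀ : ℤ} {s : ℕ} {k : ℤ} {m : ℕ}
    (hm : (m : ℤ) = c₀ + s * k) : realChar χ m = charLine χ c₀ s k := by
  unfold realChar charLine
  congr 2
  rw [← hm]
  simp

/-! ### The level-of-distribution hypothesis and the two hyperbola halves -/

/-- **The half `t < √x` of the hyperbola method** (outer variable `b = d₂* = (n+h₂)/d₂`, weight
`χ((n+h₂)/b)`): if `F` obeys the level-of-distribution bound of Proposition 7.1 (i) (hypothesis `hF`: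
moduli `Q₁ ≤ Q_max`, `1`-bounded `q`-periodic twists `f`, intervals inside `[1, 2x]`), then for
`L₁, L₂, b ≥ 1` with `[L₁, [L₂, b]] ≤ Q_max`,
`|∑_{n ≤ x} F(n+h₁) 1_{L₁∣n+h₁} 1_{L₂∣n+h₂} 1_{b∣n+h₂} χ((n+h₂)/b)| ≤ Y (L₁|h₂-h₁|+1)² / [L₁,[L₂,b]]`:
the three divisibility conditions cut out one class `N ≡ N₀ (mod [L₁,[L₂,b]])` of `N = n + h₁`
(or nothing), on which `χ((n+h₂)/b) = χ(c₀ + s (N-N₀)/Q₁)` is a `q`-periodic function of the index,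
and `(N₀, Q₁) ≤ L₁ |h₂ - h₁|`. [cite: TaoTeravainen2021, proof of Proposition 7.2 (the case `t < √x`:
"using `d₂*` in place of `d₂`, and the `q_χ`-periodic function `χ` in place of `Φ_t`")] -/
theorem abs_crossB_le (χ : DirichletCharacter ℂ q) (F : ℕ → ℝ) {x : ℕ} {Qmax Y : ℝ} (hY : 0 ≤ Y)
    (hF : ∀ (Q₁ : ℕ), 0 < Q₁ → (Q₁ : ℝ) ≤ Qmax →
      ∀ (a : ℤ), (((Int.gcd a Q₁ : ℕ) : ℝ) + 1) ^ 2 ≤ x →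
      ∀ (f : ℤ → ℝ), (∀ k, |f k| ≤ 1) → (∀ k : ℤ, f (k + q) = f k) →
      ∀ (N₁ N₂ : ℕ), 1 ≤ N₁ → (N₂ : ℝ) ≤ 2 * x →
        |∑ N ∈ (Icc N₁ N₂).filter (fun N : ℕ => (N : ℤ) ≡ a [ZMOD Q₁]),
            F N * f (((N : ℤ) - a) / Q₁)| ≤ Y * (((Int.gcd a Q₁ : ℕ) : ℝ) + 1) ^ 2 / Q₁)
    {h₁ h₂ : ℕ} (hne : h₁ ≠ h₂) (hh₁ : h₁ ≤ x) {L₁ L₂ b : ℕ} (hL₁ : 1 ≤ L₁) (hL₂ : 1 ≤ L₂)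
    (hb : 1 ≤ b) (hQ : ((Nat.lcm L₁ (Nat.lcm L₂ b) : ℕ) : ℝ) ≤ Qmax)
    (hgcd : ((L₁ : ℝ) * (((h₂ : ℤ) - h₁).natAbs : ℕ) + 1) ^ 2 ≤ x) :
    |∑ n ∈ Icc 1 x, (if L₁ ∣ n + h₁ ∧ L₂ ∣ n + h₂ ∧ b ∣ n + h₂ then
        F (n + h₁) * realChar χ ((n + h₂) / b) else 0)| ≤
      Y * ((L₁ : ℝ) * (((h₂ : ℤ) - h₁).natAbs : ℕ) + 1) ^ 2 / (Nat.lcm L₁ (Nat.lcm L₂ b) : ℕ) := by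
  set M : ℕ := Nat.lcm L₂ b with hM
  set Q₁ : ℕ := Nat.lcm L₁ M with hQ₁
  set Δ : ℤ := (h₂ : ℤ) - h₁ with hΔ
  have hΔ0 : Δ ≠ 0 := by
    rw [hΔ, sub_ne_zero]
    exact_mod_cast hne.symm
  have hM0 : 0 < M := Nat.lcm_pos (by omega) (by omega)
  have hQ₁0 : 0 < Q₁ := Nat.lcm_pos (by omega) hM0
  have hRHS : 0 ≤ Y * ((L₁ : ℝ) * ((Δ.natAbs : ℕ) : ℝ) + 1) ^ 2 / (Q₁ : ℝ) := by positivity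
  by_cases hsol : ∃ n ∈ Icc 1 x, L₁ ∣ n + h₁ ∧ L₂ ∣ n + h₂ ∧ b ∣ n + h₂
  swap
  · rw [Finset.sum_eq_zero (fun n hn => if_neg (fun h => hsol ⟨n, hn, h⟩)), abs_zero]
    exact hRHS
  obtain ⟨n₀, -, hL₁n₀, hL₂n₀, hbn₀⟩ := hsol
  set N₀ : ℤ := ((n₀ + h₁ : ℕ) : ℤ) with hN₀
  have h1 : (L₁ : ℤ) ∣ N₀ := by rw [hN₀]; exact_mod_cast hL₁n₀
  have hbΔ : (b : ℤ) ∣ N₀ + Δ := by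
    have h' : N₀ + Δ = ((n₀ + h₂ : ℕ) : ℤ) := by rw [hN₀, hΔ]; push_cast; ring
    rw [h']; exact_mod_cast hbn₀
  have h2 : (M : ℤ) ∣ N₀ + Δ := by
    have : M ∣ n₀ + h₂ := Nat.lcm_dvd hL₂n₀ hbn₀
    have h' : N₀ + Δ = ((n₀ + h₂ : ℕ) : ℤ) := by rw [hN₀, hΔ]; push_cast; ring
    rw [h']; exact_mod_cast this
  -- the system as one congruence on `N = n + h₁`
  have hiff : ∀ n : ℕ, (L₁ ∣ n + h₁ ∧ L₂ ∣ n + h₂ ∧ b ∣ n + h₂) ↔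
      ((n + h₁ : ℕ) : ℤ) ≡ N₀ [ZMOD (Q₁ : ℕ)] := by
    intro n
    rw [hQ₁, ← dvd_and_dvd_add_iff_modEq h1 h2]
    have h' : ((n + h₁ : ℕ) : ℤ) + Δ = ((n + h₂ : ℕ) : ℤ) := by rw [hΔ]; push_cast; ring
    rw [h', Int.natCast_dvd_natCast, Int.natCast_dvd_natCast, hM]
    constructor
    · rintro ⟨ha, hb', hc⟩
      exact ⟨ha, Nat.lcm_dvd hb' hc⟩
    · rintro ⟨ha, hbc⟩
      exact ⟨ha, (Nat.dvd_lcm_left _ _).trans hbc, (Nat.dvd_lcm_right _ _).trans hbc⟩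
  -- the character weight along the class
  have hbQ : b ∣ Q₁ := (Nat.dvd_lcm_right L₂ b).trans (Nat.dvd_lcm_right L₁ M)
  obtain ⟨s, hs⟩ := hbQ
  obtain ⟨c₀, hc₀⟩ := hbΔ
  have hb0 : (b : ℤ) ≠ 0 := by exact_mod_cast (show b ≠ 0 by omega)
  have hQ₁0' : (Q₁ : ℤ) ≠ 0 := by exact_mod_cast hQ₁0.ne'
  have hchar : ∀ n : ℕ, ((n + h₁ : ℕ) : ℤ) ≡ N₀ [ZMOD (Q₁ : ℕ)] →
      realChar χ ((n + h₂) / b) = charLine χ c₀ s ((((n + h₁ : ℕ) : ℤ) - N₀) / Q₁) := by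
    intro n hn
    have hsys := (hiff n).mpr hn
    obtain ⟨m, hm⟩ := hsys.2.2
    have hmdiv : (n + h₂) / b = m := by rw [hm, Nat.mul_div_cancel_left _ (by omega)]
    rw [hmdiv]
    apply realChar_eq_charLine
    obtain ⟨k, hk⟩ := hn.symm.dvd
    have hkdiv : (((n + h₁ : ℕ) : ℤ) - N₀) / Q₁ = k := by
      rw [hk, Int.mul_ediv_cancel_left _ hQ₁0']
    rw [hkdiv]
    -- `b m = N + Δ = (N - N₀) + (N₀ + Δ) = b s k + b c₀`
    have hbm : (b : ℤ) * m = ((n + h₁ : ℕ) : ℤ) + Δ := by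
      have : ((n + h₂ : ℕ) : ℤ) = ((n + h₁ : ℕ) : ℤ) + Δ := by rw [hΔ]; push_cast; ring
      rw [← this, hm]; push_cast; ring
    have hkey : (b : ℤ) * m = (b : ℤ) * (c₀ + s * k) := by
      rw [hbm]
      have hN : ((n + h₁ : ℕ) : ℤ) = N₀ + Q₁ * k := by linarith
      rw [hN, hs]
      push_cast
      linear_combination hc₀
    exact mul_left_cancel₀ hb0 hkey
  -- rewrite the sum over the class of `N = n + h₁`
  have hsum : ∑ n ∈ Icc 1 x, (if L₁ ∣ n + h₁ ∧ L₂ ∣ n + h₂ ∧ b ∣ n + h₂ then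
        F (n + h₁) * realChar χ ((n + h₂) / b) else 0) =
      ∑ N ∈ (Icc (1 + h₁) (x + h₁)).filter (fun N : ℕ => (N : ℤ) ≡ N₀ [ZMOD (Q₁ : ℕ)]),
        F N * charLine χ c₀ s (((N : ℤ) - N₀) / Q₁) := by
    rw [Finset.sum_filter, ← Finset.map_add_right_Icc, Finset.sum_map]
    refine Finset.sum_congr rfl fun n _ => ?_
    simp only [addRightEmbedding_apply]
    by_cases hc : L₁ ∣ n + h₁ ∧ L₂ ∣ n + h₂ ∧ b ∣ n + h₂
    · rw [if_pos hc, if_pos ((hiff n).mp hc), hchar n ((hiff n).mp hc)]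
    · rw [if_neg hc, if_neg (fun h => hc ((hiff n).mpr h))]
  rw [hsum]
  have hgcd' : (((Int.gcd N₀ Q₁ : ℕ) : ℝ) + 1) ^ 2 ≤ ((L₁ : ℝ) * ((Δ.natAbs : ℕ) : ℝ) + 1) ^ 2 := by
    have := gcd_le_of_dvd_of_dvd_add (M := M) hL₁ hΔ0 h1 h2
    have h' : ((Int.gcd N₀ Q₁ : ℕ) : ℝ) ≤ (L₁ : ℝ) * ((Δ.natAbs : ℕ) : ℝ) := by
      rw [hQ₁]; exact_mod_cast this
    have h0 : (0 : ℝ) ≤ ((Int.gcd N₀ Q₁ : ℕ) : ℝ) := Nat.cast_nonneg _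
    nlinarith
  have hx2 : ((x + h₁ : ℕ) : ℝ) ≤ 2 * x := by
    push_cast
    have : (h₁ : ℝ) ≤ x := by exact_mod_cast hh₁
    linarith
  have hb' := hF Q₁ hQ₁0 hQ N₀ (hgcd'.trans hgcd) (charLine χ c₀ s) (abs_charLine_le χ c₀ s)
    (charLine_add χ c₀ s) (1 + h₁) (x + h₁) (by omega) hx2
  calc |∑ N ∈ (Icc (1 + h₁) (x + h₁)).filter (fun N : ℕ => (N : ℤ) ≡ N₀ [ZMOD (Q₁ : ℕ)]),
          F N * charLine χ c₀ s (((N : ℤ) - N₀) / Q₁)|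
      ≤ Y * (((Int.gcd N₀ Q₁ : ℕ) : ℝ) + 1) ^ 2 / Q₁ := hb'
    _ ≤ Y * ((L₁ : ℝ) * ((Δ.natAbs : ℕ) : ℝ) + 1) ^ 2 / Q₁ := by
        gcongr

/-- **The half `t ≥ √x` of the hyperbola method** (outer variable `a = d₂`, smooth weight
`Φ_t((n+h₂)/a) = φ(log((n+h₂)/a) - u)`): with `F`, `hF` as in `abs_crossB_le`, `|φ| ≤ B_φ`,
`|φ'| ≤ B₁`, and `[L₁, [L₂, a]] ≤ Q_max`,
`|∑_{n ≤ x} F(n+h₁) 1_{L₁∣n+h₁} 1_{L₂∣n+h₂} 1_{a∣n+h₂} φ(log((n+h₂)/a) - u)|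
≤ Y (L₁|h₂-h₁|+1)²/[L₁,[L₂,a]] · (B_φ + B₁ log(x + h₂))` — one class modulo `[L₁,[L₂,a]]`, then Abel
summation (`abs_sum_Icc_mul_le_of_partial`) against the slowly varying weight, whose variation is
`≤ B₁ log(x+h₂)` (`sum_abs_bump_log_sub_le`), the partial sums being instances of `hF` with `f ≡ 1`.
[cite: TaoTeravainen2021, proof of Proposition 7.2 (the case `t ≥ √x`: "using summation by parts to
deal with the slowly varying function `Φ_t((n+h₂)/d₂)`, we can again bound this expression by (7.15)")] -/
theorem abs_crossA_le (F : ℕ → ℝ) {x : ℕ} {Qmax Y : ℝ} (hY : 0 ≤ Y)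
    (hF : ∀ (Q₁ : ℕ), 0 < Q₁ → (Q₁ : ℝ) ≤ Qmax →
      ∀ (a : ℤ), (((Int.gcd a Q₁ : ℕ) : ℝ) + 1) ^ 2 ≤ x →
      ∀ (f : ℤ → ℝ), (∀ k, |f k| ≤ 1) → (∀ k : ℤ, f (k + q) = f k) →
      ∀ (N₁ N₂ : ℕ), 1 ≤ N₁ → (N₂ : ℝ) ≤ 2 * x →
        |∑ N ∈ (Icc N₁ N₂).filter (fun N : ℕ => (N : ℤ) ≡ a [ZMOD Q₁]),
            F N * f (((N : ℤ) - a) / Q₁)| ≤ Y * (((Int.gcd a Q₁ : ℕ) : ℝ) + 1) ^ 2 / Q₁)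
    {φ : ℝ → ℝ} (hφ : IsBump φ) {Bφ B₁ : ℝ} (hBφ : ∀ u, |φ u| ≤ Bφ) (hB₁ : ∀ u, |deriv φ u| ≤ B₁)
    {h₁ h₂ : ℕ} (hne : h₁ ≠ h₂) (hx : 1 ≤ x) (hh₁ : h₁ ≤ x) {L₁ L₂ a : ℕ} (hL₁ : 1 ≤ L₁)
    (hL₂ : 1 ≤ L₂) (ha : 1 ≤ a) (hQ : ((Nat.lcm L₁ (Nat.lcm L₂ a) : ℕ) : ℝ) ≤ Qmax)
    (hgcd : ((L₁ : ℝ) * (((h₂ : ℤ) - h₁).natAbs : ℕ) + 1) ^ 2 ≤ x) (u : ℝ) :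
    |∑ n ∈ Icc 1 x, (if L₁ ∣ n + h₁ ∧ L₂ ∣ n + h₂ ∧ a ∣ n + h₂ then
        F (n + h₁) * φ (Real.log (((n + h₂) / a : ℕ) : ℝ) - u) else 0)| ≤
      Y * ((L₁ : ℝ) * (((h₂ : ℤ) - h₁).natAbs : ℕ) + 1) ^ 2 / (Nat.lcm L₁ (Nat.lcm L₂ a) : ℕ) *
        (Bφ + B₁ * Real.log ((x : ℝ) + h₂)) := by
  set M : ℕ := Nat.lcm L₂ a with hM
  set Q₁ : ℕ := Nat.lcm L₁ M with hQ₁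
  set Δ : ℤ := (h₂ : ℤ) - h₁ with hΔ
  have hΔ0 : Δ ≠ 0 := by
    rw [hΔ, sub_ne_zero]
    exact_mod_cast hne.symm
  have hM0 : 0 < M := Nat.lcm_pos (by omega) (by omega)
  have hQ₁0 : 0 < Q₁ := Nat.lcm_pos (by omega) hM0
  have hBφ0 : 0 ≤ Bφ := (abs_nonneg _).trans (hBφ 0)
  have hB₁0 : 0 ≤ B₁ := (abs_nonneg _).trans (hB₁ 0)
  have hx1 : (1 : ℝ) ≤ (x : ℝ) + h₂ := by
    have : (0 : ℝ) ≤ h₂ := Nat.cast_nonneg _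
    have : (1 : ℝ) ≤ x := by exact_mod_cast hx
    linarith
  have hlog0 : 0 ≤ Real.log ((x : ℝ) + h₂) := Real.log_nonneg hx1
  have hRHS : 0 ≤ Y * ((L₁ : ℝ) * ((Δ.natAbs : ℕ) : ℝ) + 1) ^ 2 / (Q₁ : ℝ) *
      (Bφ + B₁ * Real.log ((x : ℝ) + h₂)) := by positivity
  by_cases hsol : ∃ n ∈ Icc 1 x, L₁ ∣ n + h₁ ∧ L₂ ∣ n + h₂ ∧ a ∣ n + h₂
  swap
  · rw [Finset.sum_eq_zero (fun n hn => if_neg (fun h => hsol ⟨n, hn, h⟩)), abs_zero]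
    exact hRHS
  obtain ⟨n₀, -, hL₁n₀, hL₂n₀, han₀⟩ := hsol
  set N₀ : ℤ := ((n₀ + h₁ : ℕ) : ℤ) with hN₀
  have h1 : (L₁ : ℤ) ∣ N₀ := by rw [hN₀]; exact_mod_cast hL₁n₀
  have h2 : (M : ℤ) ∣ N₀ + Δ := by
    have : M ∣ n₀ + h₂ := Nat.lcm_dvd hL₂n₀ han₀
    have h' : N₀ + Δ = ((n₀ + h₂ : ℕ) : ℤ) := by rw [hN₀, hΔ]; push_cast; ring
    rw [h']; exact_mod_cast this
  -- the system as one congruence on `N = n + h₁`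
  have hiff : ∀ n : ℕ, (L₁ ∣ n + h₁ ∧ L₂ ∣ n + h₂ ∧ a ∣ n + h₂) ↔
      ((n + h₁ : ℕ) : ℤ) ≡ N₀ [ZMOD (Q₁ : ℕ)] := by
    intro n
    rw [hQ₁, ← dvd_and_dvd_add_iff_modEq h1 h2]
    have h' : ((n + h₁ : ℕ) : ℤ) + Δ = ((n + h₂ : ℕ) : ℤ) := by rw [hΔ]; push_cast; ring
    rw [h', Int.natCast_dvd_natCast, Int.natCast_dvd_natCast, hM]
    constructor
    · rintro ⟨ha', hb', hc⟩
      exact ⟨ha', Nat.lcm_dvd hb' hc⟩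
    · rintro ⟨ha', hbc⟩
      exact ⟨ha', (Nat.dvd_lcm_left _ _).trans hbc, (Nat.dvd_lcm_right _ _).trans hbc⟩
  -- the smooth weight as a function of `N`
  set δ : ℝ := (h₂ : ℝ) - h₁ with hδ
  set c : ℝ := Real.log a + u with hc
  set w : ℕ → ℝ := fun N => φ (Real.log ((N : ℝ) + δ) - c) with hw
  have ha0 : (a : ℝ) ≠ 0 := by exact_mod_cast (show a ≠ 0 by omega)
  have hweight : ∀ n : ℕ, 1 ≤ n → a ∣ n + h₂ →
      φ (Real.log (((n + h₂) / a : ℕ) : ℝ) - u) = w (n + h₁) := by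
    intro n hn1 han
    simp only [hw]
    have hpos : (0 : ℝ) < ((n + h₂ : ℕ) : ℝ) := by
      have : 0 < n + h₂ := by omega
      exact_mod_cast this
    have hcast : (((n + h₂) / a : ℕ) : ℝ) = ((n + h₂ : ℕ) : ℝ) / a := Nat.cast_div han ha0
    have hN : ((n + h₁ : ℕ) : ℝ) + δ = ((n + h₂ : ℕ) : ℝ) := by rw [hδ]; push_cast; ring
    rw [hcast, hN, Real.log_div hpos.ne' ha0, hc]
    ring_nf
  -- rewrite the sum over `N = n + h₁`
  set G : ℕ → ℝ := fun N => if (N : ℤ) ≡ N₀ [ZMOD (Q₁ : ℕ)] then F N else 0 with hG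
  have hsum : ∑ n ∈ Icc 1 x, (if L₁ ∣ n + h₁ ∧ L₂ ∣ n + h₂ ∧ a ∣ n + h₂ then
        F (n + h₁) * φ (Real.log (((n + h₂) / a : ℕ) : ℝ) - u) else 0) =
      ∑ N ∈ Icc (1 + h₁) (x + h₁), G N * w N := by
    rw [← Finset.map_add_right_Icc, Finset.sum_map]
    refine Finset.sum_congr rfl fun n hn => ?_
    have hn1 : 1 ≤ n := (mem_Icc.mp hn).1
    simp only [addRightEmbedding_apply, hG]
    by_cases hcn : L₁ ∣ n + h₁ ∧ L₂ ∣ n + h₂ ∧ a ∣ n + h₂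
    · rw [if_pos hcn, if_pos ((hiff n).mp hcn), hweight n hn1 hcn.2.2]
    · rw [if_neg hcn, if_neg (fun h => hcn ((hiff n).mpr h)), zero_mul]
  rw [hsum]
  -- the partial sums, by `hF` with `f ≡ 1`
  have hgcd' : (((Int.gcd N₀ Q₁ : ℕ) : ℝ) + 1) ^ 2 ≤ ((L₁ : ℝ) * ((Δ.natAbs : ℕ) : ℝ) + 1) ^ 2 := by
    have := gcd_le_of_dvd_of_dvd_add (M := M) hL₁ hΔ0 h1 h2
    have h' : ((Int.gcd N₀ Q₁ : ℕ) : ℝ) ≤ (L₁ : ℝ) * ((Δ.natAbs : ℕ) : ℝ) := by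
      rw [hQ₁]; exact_mod_cast this
    have h0 : (0 : ℝ) ≤ ((Int.gcd N₀ Q₁ : ℕ) : ℝ) := Nat.cast_nonneg _
    nlinarith
  set S : ℝ := Y * ((L₁ : ℝ) * ((Δ.natAbs : ℕ) : ℝ) + 1) ^ 2 / (Q₁ : ℝ) with hS
  have hS0 : 0 ≤ S := by positivity
  have hpartial : ∀ N ∈ Icc (1 + h₁) (x + h₁), |∑ K ∈ Icc (1 + h₁) N, G K| ≤ S := by
    intro N hN
    rw [mem_Icc] at hN
    have hx2 : (N : ℝ) ≤ 2 * x := by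
      have h' : (N : ℝ) ≤ ((x + h₁ : ℕ) : ℝ) := by exact_mod_cast hN.2
      push_cast at h'
      have : (h₁ : ℝ) ≤ x := by exact_mod_cast hh₁
      linarith
    have hb' := hF Q₁ hQ₁0 hQ N₀ (hgcd'.trans hgcd) (fun _ => 1) (fun _ => by simp)
      (fun _ => rfl) (1 + h₁) N (by omega) hx2
    simp only [mul_one, Finset.sum_filter] at hb'
    calc |∑ K ∈ Icc (1 + h₁) N, G K| ≤ Y * (((Int.gcd N₀ Q₁ : ℕ) : ℝ) + 1) ^ 2 / Q₁ := hb'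
      _ ≤ S := by rw [hS]; gcongr
  -- the weight: size and variation
  have hwB : |w (x + h₁)| ≤ Bφ := hBφ _
  have hwV : ∑ N ∈ Ico (1 + h₁) (x + h₁), |w (N + 1) - w N| ≤ B₁ * Real.log ((x : ℝ) + h₂) := by
    have hδpos : 0 < ((1 + h₁ : ℕ) : ℝ) + δ := by
      rw [hδ]; push_cast
      have : (0 : ℝ) ≤ h₂ := Nat.cast_nonneg _
      linarith
    have hv := sum_abs_bump_log_sub_le hφ hB₁ c (N₁ := 1 + h₁) (N₂ := x + h₁) (by omega) hδpos
    have hend : ((x + h₁ : ℕ) : ℝ) + δ = (x : ℝ) + h₂ := by rw [hδ]; push_cast; ring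
    have hstart : ((1 + h₁ : ℕ) : ℝ) + δ = 1 + h₂ := by rw [hδ]; push_cast; ring
    rw [hend, hstart] at hv
    have hlog1 : 0 ≤ Real.log (1 + (h₂ : ℝ)) := Real.log_nonneg (by
      have : (0 : ℝ) ≤ h₂ := Nat.cast_nonneg _
      linarith)
    calc ∑ N ∈ Ico (1 + h₁) (x + h₁), |w (N + 1) - w N|
        = ∑ N ∈ Ico (1 + h₁) (x + h₁),
            |φ (Real.log ((N : ℝ) + 1 + δ) - c) - φ (Real.log ((N : ℝ) + δ) - c)| := by
          refine Finset.sum_congr rfl fun N _ => ?_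
          simp only [hw]
          push_cast
          ring_nf
      _ ≤ B₁ * (Real.log ((x : ℝ) + h₂) - Real.log (1 + (h₂ : ℝ))) := hv
      _ ≤ B₁ * Real.log ((x : ℝ) + h₂) := by
          apply mul_le_mul_of_nonneg_left _ hB₁0
          linarith
  have := abs_sum_Icc_mul_le_of_partial G w hS0 hpartial hwB hwV
  simpa only [hS] using this

/-! ### The sum `T(L₁, L₂, u)` and the hyperbola method -/

/-- `T(L₁,L₂,u) := ∑_{n ≤ x} F(n+h₁) 1_{L₁∣n+h₁} 1_{L₂∣n+h₂} K_u(n+h₂)`, `K_u = χ∗Φ_{e^u}` (`hypK`).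
[cite: TaoTeravainen2021, proof of Proposition 7.2, (7.16)] -/
def crossT (χ : DirichletCharacter ℂ q) (φ : ℝ → ℝ) (F : ℕ → ℝ) (h₁ h₂ L₁ L₂ x : ℕ) (u : ℝ) : ℝ :=
  ∑ n ∈ Icc 1 x, if L₁ ∣ n + h₁ ∧ L₂ ∣ n + h₂ then F (n + h₁) * hypK χ φ u (n + h₂) else 0

/-- A divisor sum as a sum over `[1, X]` with the indicator `1_{d ∣ m}` (`1 ≤ m ≤ X`). [folklore] -/
theorem sum_divisors_eq_sum_Icc_ite {m X : ℕ} (hm : 1 ≤ m) (hmX : m ≤ X) (g : ℕ → ℝ) :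
    ∑ d ∈ m.divisors, g d = ∑ d ∈ Icc 1 X, if d ∣ m then g d else 0 := by
  rw [← Finset.sum_filter]
  congr 1
  ext d
  simp only [Nat.mem_divisors, Finset.mem_filter, mem_Icc]
  constructor
  · rintro ⟨hd, -⟩
    exact ⟨⟨Nat.pos_of_dvd_of_pos hd (by omega), (Nat.le_of_dvd (by omega) hd).trans hmX⟩, hd⟩
  · rintro ⟨⟨-, -⟩, hd⟩
    exact ⟨hd, by omega⟩

/-- **Hyperbola expansion, outer variable `a = d₂`**:
`T = ∑_{a ≤ x+h₂} χ(a) ∑_{n ≤ x} F(n+h₁) 1_{L₁∣n+h₁} 1_{L₂∣n+h₂} 1_{a∣n+h₂} φ(log((n+h₂)/a) - u)`.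
[cite: TaoTeravainen2021, proof of Proposition 7.2 ("`∑_{d₂ ∣ n+h₂} χ(d₂) Φ_t((n+h₂)/d₂)`")] -/
theorem crossT_eq_sum_outer_a (χ : DirichletCharacter ℂ q) (φ : ℝ → ℝ) (F : ℕ → ℝ)
    (h₁ h₂ L₁ L₂ x : ℕ) (u : ℝ) :
    crossT χ φ F h₁ h₂ L₁ L₂ x u = ∑ a ∈ Icc 1 (x + h₂), realChar χ a *
      ∑ n ∈ Icc 1 x, (if L₁ ∣ n + h₁ ∧ L₂ ∣ n + h₂ ∧ a ∣ n + h₂ then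
        F (n + h₁) * φ (Real.log (((n + h₂) / a : ℕ) : ℝ) - u) else 0) := by
  unfold crossT
  simp_rw [Finset.mul_sum]
  rw [Finset.sum_comm]
  refine Finset.sum_congr rfl fun n hn => ?_
  have hn1 : 1 ≤ n := (mem_Icc.mp hn).1
  have hnx : n ≤ x := (mem_Icc.mp hn).2
  by_cases hc : L₁ ∣ n + h₁ ∧ L₂ ∣ n + h₂
  · rw [if_pos hc, hypK, Nat.sum_divisorsAntidiagonal (fun a b => realChar χ a * φ (Real.log b - u)),
      Finset.mul_sum, sum_divisors_eq_sum_Icc_ite (X := x + h₂) (by omega) (by omega)]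
    refine Finset.sum_congr rfl fun a _ => ?_
    by_cases ha : a ∣ n + h₂
    · rw [if_pos ha, if_pos ⟨hc.1, hc.2, ha⟩]; ring
    · rw [if_neg ha, if_neg (fun h => ha h.2.2), mul_zero]
  · rw [if_neg hc]
    symm
    refine Finset.sum_eq_zero fun a _ => ?_
    rw [if_neg (fun h => hc ⟨h.1, h.2.1⟩), mul_zero]

/-- **Hyperbola expansion, outer variable `b = d₂* = (n+h₂)/d₂`**:
`T = ∑_{b ≤ x+h₂} φ(log b - u) ∑_{n ≤ x} F(n+h₁) 1_{L₁∣n+h₁} 1_{L₂∣n+h₂} 1_{b∣n+h₂} χ((n+h₂)/b)`.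
[cite: TaoTeravainen2021, proof of Proposition 7.2 ("we make the change of variables `d₂* := (n+h₂)/d₂`")] -/
theorem crossT_eq_sum_outer_b (χ : DirichletCharacter ℂ q) (φ : ℝ → ℝ) (F : ℕ → ℝ)
    (h₁ h₂ L₁ L₂ x : ℕ) (u : ℝ) :
    crossT χ φ F h₁ h₂ L₁ L₂ x u = ∑ b ∈ Icc 1 (x + h₂), φ (Real.log b - u) *
      ∑ n ∈ Icc 1 x, (if L₁ ∣ n + h₁ ∧ L₂ ∣ n + h₂ ∧ b ∣ n + h₂ then
        F (n + h₁) * realChar χ ((n + h₂) / b) else 0) := by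
  unfold crossT
  simp_rw [Finset.mul_sum]
  rw [Finset.sum_comm]
  refine Finset.sum_congr rfl fun n hn => ?_
  have hn1 : 1 ≤ n := (mem_Icc.mp hn).1
  have hnx : n ≤ x := (mem_Icc.mp hn).2
  by_cases hc : L₁ ∣ n + h₁ ∧ L₂ ∣ n + h₂
  · rw [if_pos hc, hypK, Nat.sum_divisorsAntidiagonal' (fun a b => realChar χ a * φ (Real.log b - u)),
      Finset.mul_sum, sum_divisors_eq_sum_Icc_ite (X := x + h₂) (by omega) (by omega)]
    refine Finset.sum_congr rfl fun b _ => ?_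
    by_cases hb : b ∣ n + h₂
    · rw [if_pos hb, if_pos ⟨hc.1, hc.2, hb⟩]; ring
    · rw [if_neg hb, if_neg (fun h => hb h.2.2), mul_zero]
  · rw [if_neg hc]
    symm
    refine Finset.sum_eq_zero fun b _ => ?_
    rw [if_neg (fun h => hc ⟨h.1, h.2.1⟩), mul_zero]

/-- For `t = e^u ≥ √x` the weight `Φ_t((n+h₂)/a)` vanishes once `a > 2e√x` (`n + h₂ ≤ 2x`): "the
summand vanishes unless `d₂ ≪ √x`". [cite: TaoTeravainen2021, proof of Proposition 7.2] -/
theorem bump_log_div_eq_zero {φ : ℝ → ℝ} (hφ : IsBump φ) {x : ℕ} (hx : 1 ≤ x) {u : ℝ}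
    (hu : Real.log x / 2 ≤ u) {m a : ℕ} (hm : 1 ≤ m) (hmx : m ≤ 2 * x) (ha : a ∣ m)
    (hbig : 2 * Real.exp 1 * Real.sqrt x < a) : φ (Real.log ((m / a : ℕ) : ℝ) - u) = 0 := by
  have hx0 : (0 : ℝ) < x := by exact_mod_cast hx
  have hsx : 0 < Real.sqrt x := Real.sqrt_pos.mpr hx0
  have ha0 : 0 < a := Nat.pos_of_dvd_of_pos ha (by omega)
  have ha0' : (0 : ℝ) < a := by exact_mod_cast ha0
  have hcast : ((m / a : ℕ) : ℝ) = (m : ℝ) / a := Nat.cast_div ha ha0'.ne'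
  have hb0 : (0 : ℝ) < (m : ℝ) / a := div_pos (by exact_mod_cast hm) ha0'
  -- `m/a < 2x/(2e√x) = √x/e`
  have hlt : (m : ℝ) / a < Real.sqrt x / Real.exp 1 := by
    rw [div_lt_div_iff₀ ha0' (Real.exp_pos 1)]
    have hm' : (m : ℝ) ≤ 2 * x := by exact_mod_cast hmx
    have hxx : (x : ℝ) = Real.sqrt x * Real.sqrt x := (Real.mul_self_sqrt hx0.le).symm
    nlinarith [Real.exp_pos 1]
  have hlog : Real.log ((m : ℝ) / a) < Real.log x / 2 - 1 := by
    have := Real.log_lt_log hb0 hlt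
    rwa [Real.log_div hsx.ne' (Real.exp_pos 1).ne', Real.log_exp, Real.log_sqrt hx0.le] at this
  rw [hcast]
  refine hφ.eq_zero _ ?_
  rw [abs_of_neg (by linarith)]
  linarith

/-- For `t = e^u < √x` the weight `Φ_t(b) = φ(log b - u)` vanishes once `b > 2e√x`.
[cite: TaoTeravainen2021, proof of Proposition 7.2 ("Observe that the summand vanishes unless
`d₂* ≪ √x`")] -/
theorem bump_log_eq_zero {φ : ℝ → ℝ} (hφ : IsBump φ) {x : ℕ} (hx : 1 ≤ x) {u : ℝ}
    (hu : u < Real.log x / 2) {b : ℕ} (hbig : 2 * Real.exp 1 * Real.sqrt x < b) :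
    φ (Real.log b - u) = 0 := by
  have hx0 : (0 : ℝ) < x := by exact_mod_cast hx
  have hsx : 0 < Real.sqrt x := Real.sqrt_pos.mpr hx0
  have hpos : 0 < 2 * Real.exp 1 * Real.sqrt x := by positivity
  have hb0 : (0 : ℝ) < b := hpos.trans hbig
  have hlog : Real.log x / 2 + 1 < Real.log b := by
    have h1 := Real.log_lt_log hpos hbig
    rw [Real.log_mul (by positivity) hsx.ne', Real.log_mul (by norm_num) (Real.exp_pos 1).ne',
      Real.log_exp, Real.log_sqrt hx0.le] at h1
    have h2 : 0 < Real.log 2 := Real.log_pos (by norm_num)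
    linarith
  refine hφ.eq_zero _ ?_
  rw [abs_of_pos (by linarith)]
  linarith

/-- `∑_{d=1}^{N} 1/d ≤ 1 + log N` (Mathlib's `harmonic_le_one_add_log`). [folklore] -/
theorem sum_Icc_one_div_le_one_add_log (N : ℕ) : ∑ d ∈ Icc 1 N, (1 : ℝ) / d ≤ 1 + Real.log N := by
  have h := harmonic_le_one_add_log N
  rw [harmonic_eq_sum_Icc, Rat.cast_sum] at h
  push_cast at h
  simpa only [one_div] using h

/-- **The bound for `T(L₁, L₂, u)`** ((7.16) at `k = 2`, `ℓ = 0`, for one `t = e^u`): with `F`, `hF`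
as in `abs_crossB_le`, `L₁ L₂ (2e√x + 1) ≤ Q_max` and `(L₁|h₂-h₁|+1)² ≤ x`,
`|T(L₁,L₂,u)| ≤ Y (L₁|h₂-h₁|+1)² (2B_φ + B₁ log(x+h₂)) (1 + log(2e√x+1))`: the hyperbola method
with the cut at `√x` (`crossT_eq_sum_outer_a` and `abs_crossA_le` for `u ≥ ½ log x`,
`crossT_eq_sum_outer_b` and `abs_crossB_le` for `u < ½ log x`), the outer variable running over
`d ≤ 2e√x` (`bump_log_div_eq_zero`, `bump_log_eq_zero`) with `1/[L₁,[L₂,d]] ≤ 1/d` and the harmonic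
sum. [cite: TaoTeravainen2021, proof of Proposition 7.2 ((7.11)–(7.12) via (7.16) and the hyperbola
method)] -/
theorem abs_crossT_le (χ : DirichletCharacter ℂ q) {φ : ℝ → ℝ} (hφ : IsBump φ) {Bφ B₁ : ℝ}
    (hBφ : ∀ u, |φ u| ≤ Bφ) (hB₁ : ∀ u, |deriv φ u| ≤ B₁) (F : ℕ → ℝ) {x : ℕ} (hx : 1 ≤ x)
    {Qmax Y : ℝ} (hY : 0 ≤ Y)
    (hF : ∀ (Q₁ : ℕ), 0 < Q₁ → (Q₁ : ℝ) ≤ Qmax →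
      ∀ (a : ℤ), (((Int.gcd a Q₁ : ℕ) : ℝ) + 1) ^ 2 ≤ x →
      ∀ (f : ℤ → ℝ), (∀ k, |f k| ≤ 1) → (∀ k : ℤ, f (k + q) = f k) →
      ∀ (N₁ N₂ : ℕ), 1 ≤ N₁ → (N₂ : ℝ) ≤ 2 * x →
        |∑ N ∈ (Icc N₁ N₂).filter (fun N : ℕ => (N : ℤ) ≡ a [ZMOD Q₁]),
            F N * f (((N : ℤ) - a) / Q₁)| ≤ Y * (((Int.gcd a Q₁ : ℕ) : ℝ) + 1) ^ 2 / Q₁)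
    {h₁ h₂ : ℕ} (hne : h₁ ≠ h₂) (hh₁ : h₁ ≤ x) (hh₂ : h₂ ≤ x) {L₁ L₂ : ℕ} (hL₁ : 1 ≤ L₁)
    (hL₂ : 1 ≤ L₂) (hQ : (L₁ : ℝ) * L₂ * (2 * Real.exp 1 * Real.sqrt x + 1) ≤ Qmax)
    (hgcd : ((L₁ : ℝ) * (((h₂ : ℤ) - h₁).natAbs : ℕ) + 1) ^ 2 ≤ x) (u : ℝ) :
    |crossT χ φ F h₁ h₂ L₁ L₂ x u| ≤
      Y * ((L₁ : ℝ) * (((h₂ : ℤ) - h₁).natAbs : ℕ) + 1) ^ 2 * (2 * Bφ + B₁ * Real.log ((x : ℝ) + h₂)) *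
        (1 + Real.log (2 * Real.exp 1 * Real.sqrt x + 1)) := by
  have hBφ0 : 0 ≤ Bφ := (abs_nonneg _).trans (hBφ 0)
  have hB₁0 : 0 ≤ B₁ := (abs_nonneg _).trans (hB₁ 0)
  have hx0 : (0 : ℝ) < x := by exact_mod_cast hx
  have hx1 : (1 : ℝ) ≤ (x : ℝ) + h₂ := by
    have : (0 : ℝ) ≤ h₂ := Nat.cast_nonneg _
    have : (1 : ℝ) ≤ x := by exact_mod_cast hx
    linarith
  have hlog0 : 0 ≤ Real.log ((x : ℝ) + h₂) := Real.log_nonneg hx1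
  set D : ℝ := 2 * Real.exp 1 * Real.sqrt x with hD
  have hDpos : 0 < D := by positivity
  set D₀ : ℕ := ⌊D⌋₊ with hD₀
  have hD₀D : (D₀ : ℝ) ≤ D := Nat.floor_le hDpos.le
  set P : ℝ := Y * ((L₁ : ℝ) * (((h₂ : ℤ) - h₁).natAbs : ℕ) + 1) ^ 2 with hP
  have hP0 : 0 ≤ P := by positivity
  set W : ℝ := 2 * Bφ + B₁ * Real.log ((x : ℝ) + h₂) with hW
  have hW0 : 0 ≤ W := by positivity
  have hWφ : Bφ ≤ W := by rw [hW]; nlinarith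
  have hW' : Bφ + B₁ * Real.log ((x : ℝ) + h₂) ≤ W := by rw [hW]; linarith
  -- moduli: `[L₁,[L₂,d]] ≤ L₁ L₂ d ≤ Qmax` for `d ≤ D₀`, and `d ≤ [L₁,[L₂,d]]`
  have hlcm_le : ∀ d : ℕ, 1 ≤ d → d ≤ D₀ → ((Nat.lcm L₁ (Nat.lcm L₂ d) : ℕ) : ℝ) ≤ Qmax := by
    intro d hd hdD
    have h1 : Nat.lcm L₂ d ≤ L₂ * d := Nat.le_of_dvd (by positivity) (Nat.lcm_dvd_mul L₂ d)
    have h2 : Nat.lcm L₁ (Nat.lcm L₂ d) ≤ L₁ * Nat.lcm L₂ d :=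
      Nat.le_of_dvd (Nat.mul_pos (by omega) (Nat.lcm_pos (by omega) (by omega))) (Nat.lcm_dvd_mul _ _)
    have h3 : ((Nat.lcm L₁ (Nat.lcm L₂ d) : ℕ) : ℝ) ≤ (L₁ : ℝ) * (L₂ * d) := by
      have : Nat.lcm L₁ (Nat.lcm L₂ d) ≤ L₁ * (L₂ * d) := h2.trans (Nat.mul_le_mul_left _ h1)
      exact_mod_cast this
    have hdD' : (d : ℝ) ≤ D := le_trans (by exact_mod_cast hdD) hD₀D
    have hL₁0 : (0 : ℝ) ≤ L₁ := Nat.cast_nonneg _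
    have hL₂0 : (0 : ℝ) ≤ L₂ := Nat.cast_nonneg _
    calc ((Nat.lcm L₁ (Nat.lcm L₂ d) : ℕ) : ℝ) ≤ (L₁ : ℝ) * (L₂ * d) := h3
      _ = (L₁ : ℝ) * L₂ * d := by ring
      _ ≤ (L₁ : ℝ) * L₂ * (D + 1) := by
          exact mul_le_mul_of_nonneg_left (by linarith) (mul_nonneg hL₁0 hL₂0)
      _ ≤ Qmax := hQ
  have hd_le_lcm : ∀ d : ℕ, 1 ≤ d → (d : ℝ) ≤ ((Nat.lcm L₁ (Nat.lcm L₂ d) : ℕ) : ℝ) := by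
    intro d hd
    have : d ≤ Nat.lcm L₁ (Nat.lcm L₂ d) :=
      Nat.le_of_dvd (Nat.lcm_pos (by omega) (Nat.lcm_pos (by omega) (by omega)))
        ((Nat.dvd_lcm_right L₂ d).trans (Nat.dvd_lcm_right L₁ _))
    exact_mod_cast this
  have hPd : ∀ d : ℕ, 1 ≤ d →
      Y * ((L₁ : ℝ) * (((h₂ : ℤ) - h₁).natAbs : ℕ) + 1) ^ 2 / (Nat.lcm L₁ (Nat.lcm L₂ d) : ℕ) ≤
        P / d := by
    intro d hd
    rw [hP]
    exact div_le_div_of_nonneg_left (by positivity) (by exact_mod_cast hd) (hd_le_lcm d hd)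
  -- `T = ∑_{d ≤ x + h₂} term(d)` with `term(d) = 0` for `d > D₀` and `|term(d)| ≤ P W / d` otherwise
  have hkey : ∃ term : ℕ → ℝ, crossT χ φ F h₁ h₂ L₁ L₂ x u = ∑ d ∈ Icc 1 (x + h₂), term d ∧
      (∀ d ∈ Icc 1 (x + h₂), D₀ < d → term d = 0) ∧
      (∀ d ∈ Icc 1 (x + h₂), d ≤ D₀ → |term d| ≤ P * W / d) := by
    rcases le_or_gt (Real.log x / 2) u with hu | hu
    · -- the case `t ≥ √x`: outer variable `a = d₂`
      refine ⟨fun a => realChar χ a * ∑ n ∈ Icc 1 x,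
          (if L₁ ∣ n + h₁ ∧ L₂ ∣ n + h₂ ∧ a ∣ n + h₂ then
            F (n + h₁) * φ (Real.log (((n + h₂) / a : ℕ) : ℝ) - u) else 0),
        crossT_eq_sum_outer_a χ φ F h₁ h₂ L₁ L₂ x u, ?_, ?_⟩
      · intro a _ hbig
        have hbig' : D < a := Nat.lt_of_floor_lt hbig
        show realChar χ a * _ = 0
        rw [Finset.sum_eq_zero, mul_zero]
        intro n hn
        have hn1 : 1 ≤ n := (mem_Icc.mp hn).1
        have hnx : n ≤ x := (mem_Icc.mp hn).2
        by_cases hcn : L₁ ∣ n + h₁ ∧ L₂ ∣ n + h₂ ∧ a ∣ n + h₂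
        · rw [if_pos hcn, bump_log_div_eq_zero hφ hx hu (m := n + h₂) (by omega) (by omega) hcn.2.2
            hbig', mul_zero]
        · rw [if_neg hcn]
      · intro a ha haD
        have ha1 : 1 ≤ a := (mem_Icc.mp ha).1
        have ha0 : (0 : ℝ) < a := by exact_mod_cast ha1
        have hinner := abs_crossA_le F hY hF hφ hBφ hB₁ hne hx hh₁ hL₁ hL₂ ha1 (hlcm_le a ha1 haD)
          hgcd u
        rw [abs_mul]
        calc |realChar χ a| * |∑ n ∈ Icc 1 x, (if L₁ ∣ n + h₁ ∧ L₂ ∣ n + h₂ ∧ a ∣ n + h₂ then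
                F (n + h₁) * φ (Real.log (((n + h₂) / a : ℕ) : ℝ) - u) else 0)|
            ≤ 1 * (P / a * W) := by
              refine mul_le_mul (abs_realChar_le_one χ a) (hinner.trans ?_) (abs_nonneg _) zero_le_one
              exact mul_le_mul (hPd a ha1) hW' (by positivity) (by positivity)
          _ = P * W / a := by ring
    · -- the case `t < √x`: outer variable `b = d₂*`
      refine ⟨fun b => φ (Real.log b - u) * ∑ n ∈ Icc 1 x,
          (if L₁ ∣ n + h₁ ∧ L₂ ∣ n + h₂ ∧ b ∣ n + h₂ then
            F (n + h₁) * realChar χ ((n + h₂) / b) else 0),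
        crossT_eq_sum_outer_b χ φ F h₁ h₂ L₁ L₂ x u, ?_, ?_⟩
      · intro b _ hbig
        have hbig' : D < b := Nat.lt_of_floor_lt hbig
        show φ (Real.log b - u) * _ = 0
        rw [bump_log_eq_zero hφ hx hu hbig', zero_mul]
      · intro b hb hbD
        have hb1 : 1 ≤ b := (mem_Icc.mp hb).1
        have hb0 : (0 : ℝ) < b := by exact_mod_cast hb1
        have hinner := abs_crossB_le χ F hY hF hne hh₁ hL₁ hL₂ hb1 (hlcm_le b hb1 hbD) hgcd
        rw [abs_mul]
        calc |φ (Real.log b - u)| * |∑ n ∈ Icc 1 x, (if L₁ ∣ n + h₁ ∧ L₂ ∣ n + h₂ ∧ b ∣ n + h₂ then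
                F (n + h₁) * realChar χ ((n + h₂) / b) else 0)|
            ≤ W * (P / b) :=
              mul_le_mul ((hBφ _).trans hWφ) (hinner.trans (hPd b hb1)) (abs_nonneg _) hW0
          _ = P * W / b := by ring
  obtain ⟨term, hT, hzero, hbound⟩ := hkey
  rw [hT]
  calc |∑ d ∈ Icc 1 (x + h₂), term d| ≤ ∑ d ∈ Icc 1 (x + h₂), |term d| := abs_sum_le_sum_abs _ _
    _ = ∑ d ∈ (Icc 1 (x + h₂)).filter (fun d => d ≤ D₀), |term d| := by
        rw [Finset.sum_filter]
        refine Finset.sum_congr rfl fun d hd => ?_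
        split_ifs with h
        · rfl
        · rw [hzero d hd (not_le.mp h), abs_zero]
    _ ≤ ∑ d ∈ (Icc 1 (x + h₂)).filter (fun d => d ≤ D₀), P * W / d := by
        refine Finset.sum_le_sum fun d hd => ?_
        rw [Finset.mem_filter] at hd
        exact hbound d hd.1 hd.2
    _ ≤ ∑ d ∈ Icc 1 D₀, P * W / d := by
        refine Finset.sum_le_sum_of_subset_of_nonneg ?_ (fun d _ _ => by positivity)
        intro d hd
        rw [Finset.mem_filter, mem_Icc] at hd
        rw [mem_Icc]
        exact ⟨hd.1.1, hd.2⟩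
    _ = P * W * ∑ d ∈ Icc 1 D₀, (1 : ℝ) / d := by
        rw [Finset.mul_sum]
        exact Finset.sum_congr rfl fun d _ => by ring
    _ ≤ P * W * (1 + Real.log D₀) :=
        mul_le_mul_of_nonneg_left (sum_Icc_one_div_le_one_add_log D₀) (by positivity)
    _ ≤ P * W * (1 + Real.log (D + 1)) := by
        refine mul_le_mul_of_nonneg_left ?_ (by positivity)
        have : Real.log D₀ ≤ Real.log (D + 1) := by
          rcases Nat.eq_zero_or_pos D₀ with h0 | hpos
          · rw [h0, Nat.cast_zero, Real.log_zero]
            exact Real.log_nonneg (by linarith)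
          · exact Real.log_le_log (by exact_mod_cast hpos) (by linarith)
        linarith

/-! ### Expanding the two sieve weights ((7.8) at `k = 2`) -/

/-- `S(u) := ∑_{n ≤ x} F(n+h₁) ν(n+h₁) · K_u(n+h₂) ν(n+h₂)` — at `F = (χ∗log)♭` this is
`∑_{n ≤ x} Λ♭_Siegel(n+h₁) (χ∗Φ_t)(n+h₂) ν(n+h₂)`, the sum in (7.16) at `k = 2`, `ℓ = 0`.
[cite: TaoTeravainen2021, proof of Proposition 7.2, (7.16)] -/
def crossS (χ : DirichletCharacter ℂ q) (φ ψ : ℝ → ℝ) (F : ℕ → ℝ) (R : ℝ) (h₁ h₂ x : ℕ)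
    (u : ℝ) : ℝ :=
  ∑ n ∈ Icc 1 x, F (n + h₁) * selbergSieve ψ R (n + h₁) *
    (hypK χ φ u (n + h₂) * selbergSieve ψ R (n + h₂))

/-- `ν(m) = ∑_{e, e' ∈ E} λ_e λ_{e'} 1_{[e,e'] ∣ m}` (`m ≥ 1`): the expansion (7.8) of one sieve
weight. [cite: TaoTeravainen2021, §7 (7.8) and §2.5 (2.14)] -/
theorem selbergSieve_eq_sum_sum {ψ : ℝ → ℝ} (hψ : IsSmoothCutoff ψ) {R : ℝ} (hR : 1 < R) {m : ℕ}
    (hm : m ≠ 0) :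
    selbergSieve ψ R m = ∑ e ∈ sieveRange R, ∑ e' ∈ sieveRange R,
      if Nat.lcm e e' ∣ m then sieveWt ψ R e * sieveWt ψ R e' else 0 := by
  rw [selbergSieve_eq_sq hψ hR hm, sq, Finset.sum_mul_sum]
  refine Finset.sum_congr rfl fun e _ => Finset.sum_congr rfl fun e' _ => ?_
  by_cases h : Nat.lcm e e' ∣ m
  · rw [if_pos h, if_pos ((Nat.dvd_lcm_left e e').trans h),
      if_pos ((Nat.dvd_lcm_right e e').trans h)]
  · rw [if_neg h]
    by_cases he : e ∣ m
    · rw [if_pos he, if_neg (fun he' => h (Nat.lcm_dvd he he')), mul_zero]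
    · rw [if_neg he, zero_mul]

/-- **`S(u)` as a combination of the `T(L₁, L₂, u)`**:
`S(u) = ∑_{e₁,e₁',e₂,e₂' ∈ E} λ_{e₁}λ_{e₁'}λ_{e₂}λ_{e₂'} T([e₁,e₁'], [e₂,e₂'], u)` ("Expanding out
using … (7.8)"). [cite: TaoTeravainen2021, proof of Proposition 7.2] -/
theorem crossS_eq_sum (χ : DirichletCharacter ℂ q) (φ : ℝ → ℝ) {ψ : ℝ → ℝ} (hψ : IsSmoothCutoff ψ)
    (F : ℕ → ℝ) {R : ℝ} (hR : 1 < R) (h₁ h₂ x : ℕ) (u : ℝ) :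
    crossS χ φ ψ F R h₁ h₂ x u =
      ∑ e₂ ∈ sieveRange R, ∑ e₂' ∈ sieveRange R, ∑ e₁ ∈ sieveRange R, ∑ e₁' ∈ sieveRange R,
        sieveWt ψ R e₁ * sieveWt ψ R e₁' * (sieveWt ψ R e₂ * sieveWt ψ R e₂') *
          crossT χ φ F h₁ h₂ (Nat.lcm e₁ e₁') (Nat.lcm e₂ e₂') x u := by
  unfold crossS crossT
  have hn : ∀ n ∈ Icc 1 x, F (n + h₁) * selbergSieve ψ R (n + h₁) *
      (hypK χ φ u (n + h₂) * selbergSieve ψ R (n + h₂)) =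
      ∑ e₂ ∈ sieveRange R, ∑ e₂' ∈ sieveRange R, ∑ e₁ ∈ sieveRange R, ∑ e₁' ∈ sieveRange R,
        sieveWt ψ R e₁ * sieveWt ψ R e₁' * (sieveWt ψ R e₂ * sieveWt ψ R e₂') *
          (if Nat.lcm e₁ e₁' ∣ n + h₁ ∧ Nat.lcm e₂ e₂' ∣ n + h₂ then
            F (n + h₁) * hypK χ φ u (n + h₂) else 0) := by
    intro n hn
    have hn1 : 1 ≤ n := (mem_Icc.mp hn).1
    rw [selbergSieve_eq_sum_sum hψ hR (m := n + h₁) (by omega),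
      selbergSieve_eq_sum_sum hψ hR (m := n + h₂) (by omega)]
    simp only [Finset.mul_sum, Finset.sum_mul]
    refine sum_congr rfl fun e₂ _ => sum_congr rfl fun e₂' _ => sum_congr rfl fun e₁ _ =>
      sum_congr rfl fun e₁' _ => ?_
    by_cases hc1 : Nat.lcm e₁ e₁' ∣ n + h₁ <;> by_cases hc2 : Nat.lcm e₂ e₂' ∣ n + h₂ <;>
      simp [hc1, hc2]
    ring
  rw [Finset.sum_congr rfl hn, Finset.sum_comm]
  refine sum_congr rfl fun e₂ _ => ?_
  rw [Finset.sum_comm]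
  refine sum_congr rfl fun e₂' _ => ?_
  rw [Finset.sum_comm]
  refine sum_congr rfl fun e₁ _ => ?_
  rw [Finset.sum_comm]
  refine sum_congr rfl fun e₁' _ => ?_
  rw [Finset.mul_sum]

/-- `|∑_{i ∈ s} f(i)| ≤ #s · M` when `|f| ≤ M` on `s`. [folklore] -/
theorem abs_sum_le_card_mul {ι : Type*} (s : Finset ι) (f : ι → ℝ) {M : ℝ}
    (h : ∀ i ∈ s, |f i| ≤ M) : |∑ i ∈ s, f i| ≤ s.card * M :=
  (abs_sum_le_sum_abs _ _).trans ((sum_le_sum h).trans (by rw [sum_const, nsmul_eq_mul]))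

/-- **`|S(u)| ≤ R⁴ B_ψ⁴ · max_{L₁,L₂} |T(L₁,L₂,u)|`**, the maximum over `1 ≤ L₁, L₂ < R²`
(`|λ_e| ≤ B_ψ`, `#E ≤ R`, `[e,e'] < R²`). [cite: TaoTeravainen2021, proof of Proposition 7.2] -/
theorem abs_crossS_le (χ : DirichletCharacter ℂ q) (φ : ℝ → ℝ) {ψ : ℝ → ℝ} (hψ : IsSmoothCutoff ψ)
    (F : ℕ → ℝ) {R : ℝ} (hR : 1 < R) {Bψ : ℝ} (hBψ : ∀ u, |ψ u| ≤ Bψ) (h₁ h₂ x : ℕ) (u : ℝ)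
    {Tmax : ℝ} (hT0 : 0 ≤ Tmax)
    (hT : ∀ L₁ L₂ : ℕ, 1 ≤ L₁ → (L₁ : ℝ) < R ^ 2 → 1 ≤ L₂ → (L₂ : ℝ) < R ^ 2 →
      |crossT χ φ F h₁ h₂ L₁ L₂ x u| ≤ Tmax) :
    |crossS χ φ ψ F R h₁ h₂ x u| ≤ R ^ 4 * Bψ ^ 4 * Tmax := by
  have hBψ0 : 0 ≤ Bψ := (abs_nonneg _).trans (hBψ 0)
  have hR0 : 0 ≤ R := by linarith
  have hE : ∀ e ∈ sieveRange R, 1 ≤ e ∧ (e : ℝ) < R := fun e he => mem_sieveRange.mp he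
  have hlcm : ∀ e ∈ sieveRange R, ∀ e' ∈ sieveRange R,
      1 ≤ Nat.lcm e e' ∧ ((Nat.lcm e e' : ℕ) : ℝ) < R ^ 2 := by
    intro e he e' he'
    obtain ⟨he1, heR⟩ := hE e he
    obtain ⟨he1', heR'⟩ := hE e' he'
    refine ⟨Nat.lcm_pos he1 he1', ?_⟩
    have : Nat.lcm e e' ≤ e * e' := Nat.le_of_dvd (Nat.mul_pos he1 he1') (Nat.lcm_dvd_mul e e')
    calc ((Nat.lcm e e' : ℕ) : ℝ) ≤ (e : ℝ) * e' := by exact_mod_cast this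
      _ < R * R := mul_lt_mul'' heR heR' (Nat.cast_nonneg _) (Nat.cast_nonneg _)
      _ = R ^ 2 := by ring
  have hwt : ∀ e : ℕ, |sieveWt ψ R e| ≤ Bψ := fun e => abs_sieveWt_le hBψ R e
  set c : ℝ := ((sieveRange R).card : ℝ) with hc
  have hcR : c ≤ R := card_sieveRange_le hR0
  have hc0 : 0 ≤ c := Nat.cast_nonneg _
  rw [crossS_eq_sum χ φ hψ F hR h₁ h₂ x u]
  have hb : |∑ e₂ ∈ sieveRange R, ∑ e₂' ∈ sieveRange R, ∑ e₁ ∈ sieveRange R, ∑ e₁' ∈ sieveRange R,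
      sieveWt ψ R e₁ * sieveWt ψ R e₁' * (sieveWt ψ R e₂ * sieveWt ψ R e₂') *
        crossT χ φ F h₁ h₂ (Nat.lcm e₁ e₁') (Nat.lcm e₂ e₂') x u| ≤
      c * (c * (c * (c * (Bψ ^ 4 * Tmax)))) := by
    refine abs_sum_le_card_mul _ _ fun e₂ he₂ => ?_
    refine abs_sum_le_card_mul _ _ fun e₂' he₂' => ?_
    refine abs_sum_le_card_mul _ _ fun e₁ he₁ => ?_
    refine abs_sum_le_card_mul _ _ fun e₁' he₁' => ?_
    obtain ⟨hL₁, hL₁R⟩ := hlcm e₁ he₁ e₁' he₁'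
    obtain ⟨hL₂, hL₂R⟩ := hlcm e₂ he₂ e₂' he₂'
    rw [abs_mul, abs_mul, abs_mul, abs_mul]
    have hTb := hT _ _ hL₁ hL₁R hL₂ hL₂R
    calc |sieveWt ψ R e₁| * |sieveWt ψ R e₁'| * (|sieveWt ψ R e₂| * |sieveWt ψ R e₂'|) *
          |crossT χ φ F h₁ h₂ (Nat.lcm e₁ e₁') (Nat.lcm e₂ e₂') x u|
        ≤ Bψ * Bψ * (Bψ * Bψ) * Tmax := by
          refine mul_le_mul ?_ hTb (abs_nonneg _) (by positivity)
          exact mul_le_mul (mul_le_mul (hwt _) (hwt _) (abs_nonneg _) hBψ0)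
            (mul_le_mul (hwt _) (hwt _) (abs_nonneg _) hBψ0) (by positivity) (by positivity)
      _ = Bψ ^ 4 * Tmax := by ring
  calc _ ≤ c * (c * (c * (c * (Bψ ^ 4 * Tmax)))) := hb
    _ = c ^ 4 * (Bψ ^ 4 * Tmax) := by ring
    _ ≤ R ^ 4 * (Bψ ^ 4 * Tmax) := by
        refine mul_le_mul_of_nonneg_right ?_ (by positivity)
        exact pow_le_pow_left₀ hc0 hcR 4
    _ = R ^ 4 * Bψ ^ 4 * Tmax := by ring

/-! ### The cross bound for `Λ♭_Siegel` (Proposition 7.1 (i) inserted) -/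

/-- `(x^c)^n = x^{nc}`. [folklore] -/
theorem rpow_natPow {x : ℝ} (hx : 0 ≤ x) (c : ℝ) (n : ℕ) : (x ^ c) ^ n = x ^ ((n : ℝ) * c) := by
  rw [← Real.rpow_natCast, ← Real.rpow_mul hx, mul_comm]

/-- `1 + log x ≤ (1 + 1/ε) x^ε` for `x ≥ 1`, `ε > 0` (Mathlib's `Real.log_le_rpow_div`). [folklore] -/
theorem one_add_log_le_mul_rpow' {x ε : ℝ} (hx : 1 ≤ x) (hε : 0 < ε) :
    1 + Real.log x ≤ (1 + 1 / ε) * x ^ ε := by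
  have h1 : Real.log x ≤ x ^ ε / ε := Real.log_le_rpow_div (by linarith) hε
  have h2 : 1 ≤ x ^ ε := Real.one_le_rpow hx hε.le
  calc 1 + Real.log x ≤ x ^ ε + x ^ ε / ε := add_le_add h2 h1
    _ = (1 + 1 / ε) * x ^ ε := by ring

/-- `log 2 ≤ 1` and `log 7 ≤ 2`. [folklore] -/
theorem log_seven_le_two : Real.log 7 ≤ 2 := by
  have h1 : (2.7182818283 : ℝ) < Real.exp 1 := Real.exp_one_gt_d9
  have h2 : (7 : ℝ) < Real.exp 2 := by
    have : Real.exp 2 = Real.exp 1 * Real.exp 1 := by rw [← Real.exp_add]; norm_num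
    rw [this]; nlinarith [Real.exp_pos 1]
  exact (Real.log_le_iff_le_exp (by norm_num)).mpr h2.le
set_option maxHeartbeats 400000 in -- buildfix (bf3-g26): 160k/180k FAIL, 200k PASS at accept time; line-neutral budget line
/-- **The cross correlation bound** ((7.16) at `k = 2`, `ℓ = 0`, one `t = e^u`, uniformly in `u`):
for a bump `φ`, a cutoff `ψ`, `0 < ε₀ ≤ 1/100` and distinct shifts there are `c > 0`, `C`, `x₀`
such that for `x ≥ x₀` (`x ∈ ℕ`), `q ≤ x^{1/20}`, any `χ (mod q)`, `1 < R ≤ x^c` and every `u`,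
`|∑_{n ≤ x} Λ♭_Siegel(n+h₁) K_u(n+h₂) ν(n+h₂)| ≤ C x^{1-c}`, where `Λ♭_Siegel = (χ∗log)♭ ν` with
`X = log x`, `U₀ = log(D q²)`, `D = x^{ε₀/20}` (as in `prop71_i`), `ν` the Selberg sieve at level
`R` and `K_u = χ∗Φ_{e^u}`. Proof: `crossS_eq_sum`/`abs_crossS_le` (expansion (7.8) of the two sieve
weights, `R⁴ B_ψ⁴` tuples), `abs_crossT_le` (hyperbola method + Proposition 7.1 (i) = `prop71_i`
as the hypothesis `hF`, moduli `≤ R⁴ · 3e√x ≤ x^{51/100}`), and the absorption of `R⁸` and the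
logarithms into `x^{3c₇/4}`. [cite: TaoTeravainen2021, proof of Proposition 7.2 ((7.11)–(7.12) via
(7.16)) and Proposition 7.1] -/
theorem abs_flatCross_le {φ ψ : ℝ → ℝ} (hφ : IsBump φ) (hψ : IsSmoothCutoff ψ) {ε₀ : ℝ}
    (hε₀ : 0 < ε₀) (hε₀1 : ε₀ ≤ 1 / 100) {h₁ h₂ : ℕ} (hne : h₁ ≠ h₂) :
    ∃ c : ℝ, 0 < c ∧ ∃ C : ℝ, 0 ≤ C ∧ ∃ x₀ : ℝ, 1 ≤ x₀ ∧ ∀ x : ℕ, x₀ ≤ (x : ℝ) →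
      ∀ (q : ℕ) [NeZero q] (χ : DirichletCharacter ℂ q), (q : ℝ) ≤ (x : ℝ) ^ (1 / 20 : ℝ) →
      ∀ R : ℝ, 1 < R → R ≤ (x : ℝ) ^ c → ∀ u : ℝ,
        |∑ n ∈ Icc 1 x, vonMangoldtSiegelFlat χ φ ψ (Real.log x)
            (ε₀ / 20 * Real.log x + 2 * Real.log q) R (n + h₁) *
            (hypK χ φ u (n + h₂) * selbergSieve ψ R (n + h₂))| ≤ C * (x : ℝ) ^ (1 - c) := by
  obtain ⟨c₇, hc₇, C₇, hC₇, x₇, hx₇, hP⟩ := prop71_i hφ hψ hε₀ hε₀1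
  obtain ⟨Bφ, hBφ0, hBφ⟩ := hφ.exists_bound
  obtain ⟨B₁, hB₁0, hB₁⟩ := hφ.exists_bound_deriv
  obtain ⟨Bψ, hBψ0, hBψ⟩ := hψ.exists_abs_le
  set Δ : ℕ := ((h₂ : ℤ) - h₁).natAbs with hΔdef
  set c : ℝ := min (c₇ / 16) (1 / 1000) with hcdef
  have hc0 : 0 < c := lt_min (by positivity) (by norm_num)
  have hc16 : c ≤ c₇ / 16 := min_le_left _ _
  have hc1000 : c ≤ 1 / 1000 := min_le_right _ _
  set ε : ℝ := c₇ / 8 with hεdef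
  have hε : 0 < ε := by positivity
  set K₀ : ℝ := 1 + 1 / ε with hK₀
  have hK₀0 : 0 ≤ K₀ := by positivity
  set C : ℝ := Bψ ^ 4 * C₇ * ((Δ : ℝ) + 1) ^ 2 * ((2 * Bφ + B₁) * K₀) * (3 * K₀) with hCdef
  have hC0 : 0 ≤ C := by positivity
  set x₀ : ℝ := max (max x₇ ((7 : ℝ) ^ (500 / 3 : ℝ))) (max (((Δ : ℝ) + 1) ^ 4) ((h₁ : ℝ) + h₂ + 1))
    with hx₀
  refine ⟨c, hc0, C, hC0, x₀, le_trans hx₇ ((le_max_left _ _).trans (le_max_left _ _)), ?_⟩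
  intro x hx q _ χ hq R hR1 hRc u
  -- unpacking the threshold
  have hx7 : x₇ ≤ x := le_trans ((le_max_left _ _).trans (le_max_left _ _)) hx
  have hxpow : (7 : ℝ) ^ (500 / 3 : ℝ) ≤ x :=
    le_trans ((le_max_right _ _).trans (le_max_left _ _)) hx
  have hxΔ : ((Δ : ℝ) + 1) ^ 4 ≤ x := le_trans ((le_max_left _ _).trans (le_max_right _ _)) hx
  have hxh : (h₁ : ℝ) + h₂ + 1 ≤ x := le_trans ((le_max_right _ _).trans (le_max_right _ _)) hx
  have hx1r : (1 : ℝ) ≤ x := le_trans hx₇ hx7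
  have hx1 : 1 ≤ x := by exact_mod_cast hx1r
  have hx0 : (0 : ℝ) < x := by linarith
  have h0h₁ : (0 : ℝ) ≤ h₁ := Nat.cast_nonneg _
  have h0h₂ : (0 : ℝ) ≤ h₂ := Nat.cast_nonneg _
  have hh₁ : h₁ ≤ x := by
    have : (h₁ : ℝ) ≤ x := by linarith
    exact_mod_cast this
  have hh₂ : h₂ ≤ x := by
    have : (h₂ : ℝ) ≤ x := by linarith
    exact_mod_cast this
  -- the level-of-distribution input: Proposition 7.1 (i)
  have hF : ∀ (Q₁ : ℕ), 0 < Q₁ → (Q₁ : ℝ) ≤ (x : ℝ) ^ (51 / 100 : ℝ) →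
      ∀ (a : ℤ), (((Int.gcd a Q₁ : ℕ) : ℝ) + 1) ^ 2 ≤ x →
      ∀ (f : ℤ → ℝ), (∀ k, |f k| ≤ 1) → (∀ k : ℤ, f (k + q) = f k) →
      ∀ (N₁ N₂ : ℕ), 1 ≤ N₁ → (N₂ : ℝ) ≤ 2 * x →
        |∑ N ∈ (Icc N₁ N₂).filter (fun N : ℕ => (N : ℤ) ≡ a [ZMOD Q₁]),
            flatLog χ φ ψ (Real.log x) (ε₀ / 20 * Real.log x + 2 * Real.log q) N *
              f (((N : ℤ) - a) / Q₁)| ≤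
          C₇ * (x : ℝ) ^ (1 - c₇) * (((Int.gcd a Q₁ : ℕ) : ℝ) + 1) ^ 2 / Q₁ := by
    intro Q₁ hQ₁ hQ₁x a ha f hf1 hf N₁ N₂ hN₁ hN₂
    calc _ ≤ C₇ * (((Int.gcd a Q₁ : ℕ) : ℝ) + 1) ^ 2 * (x : ℝ) ^ (1 - c₇) / Q₁ :=
          hP x hx7 q χ hq Q₁ hQ₁ hQ₁x a ha f hf1 hf N₁ N₂ hN₁ hN₂
      _ = _ := by ring
  have hY : 0 ≤ C₇ * (x : ℝ) ^ (1 - c₇) := by positivity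
  -- powers of `x` and `R`
  have hR0 : 0 ≤ R := by linarith
  have hR4 : R ^ 4 ≤ (x : ℝ) ^ (1 / 250 : ℝ) := by
    calc R ^ 4 ≤ ((x : ℝ) ^ c) ^ 4 := pow_le_pow_left₀ hR0 hRc 4
      _ = (x : ℝ) ^ ((4 : ℕ) * c) := rpow_natPow hx0.le c 4
      _ ≤ (x : ℝ) ^ (1 / 250 : ℝ) := by
          refine Real.rpow_le_rpow_of_exponent_le hx1r ?_
          push_cast; linarith
  have hR8 : R ^ 8 ≤ (x : ℝ) ^ (c₇ / 2) := by
    calc R ^ 8 ≤ ((x : ℝ) ^ c) ^ 8 := pow_le_pow_left₀ hR0 hRc 8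
      _ = (x : ℝ) ^ ((8 : ℕ) * c) := rpow_natPow hx0.le c 8
      _ ≤ (x : ℝ) ^ (c₇ / 2) := by
          refine Real.rpow_le_rpow_of_exponent_le hx1r ?_
          push_cast; linarith
  have hsqrt : Real.sqrt x = (x : ℝ) ^ (1 / 2 : ℝ) := Real.sqrt_eq_rpow x
  have hsqrt1 : 1 ≤ Real.sqrt x := by rw [hsqrt]; exact Real.one_le_rpow hx1r (by norm_num)
  have he : Real.exp 1 < 2.7182818286 := Real.exp_one_lt_d9
  have h2e : 2 * Real.exp 1 * Real.sqrt x + 1 ≤ 7 * Real.sqrt x := by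
    have h6 : 2 * Real.exp 1 ≤ 6 := by linarith
    calc 2 * Real.exp 1 * Real.sqrt x + 1 ≤ 6 * Real.sqrt x + Real.sqrt x :=
          add_le_add (mul_le_mul_of_nonneg_right h6 (Real.sqrt_nonneg _)) hsqrt1
      _ = 7 * Real.sqrt x := by ring
  have h7 : (7 : ℝ) ≤ (x : ℝ) ^ (3 / 500 : ℝ) := by
    have := Real.rpow_le_rpow (by positivity) hxpow (show (0 : ℝ) ≤ 3 / 500 by norm_num)
    rwa [← Real.rpow_mul (by norm_num), show (500 / 3 : ℝ) * (3 / 500) = 1 by norm_num,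
      Real.rpow_one] at this
  -- moduli: `L₁ L₂ (2e√x + 1) ≤ R⁴ · 7√x ≤ x^{51/100}` for `L₁, L₂ < R²`
  have hQ : ∀ L₁ L₂ : ℕ, (L₁ : ℝ) < R ^ 2 → (L₂ : ℝ) < R ^ 2 →
      (L₁ : ℝ) * L₂ * (2 * Real.exp 1 * Real.sqrt x + 1) ≤ (x : ℝ) ^ (51 / 100 : ℝ) := by
    intro L₁ L₂ hL₁ hL₂
    have hL₁0 : (0 : ℝ) ≤ L₁ := Nat.cast_nonneg _
    have hL₂0 : (0 : ℝ) ≤ L₂ := Nat.cast_nonneg _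
    have hLL : (L₁ : ℝ) * L₂ ≤ R ^ 4 := by
      calc (L₁ : ℝ) * L₂ ≤ R ^ 2 * R ^ 2 := mul_le_mul hL₁.le hL₂.le hL₂0 (by positivity)
        _ = R ^ 4 := by ring
    calc (L₁ : ℝ) * L₂ * (2 * Real.exp 1 * Real.sqrt x + 1)
        ≤ R ^ 4 * (7 * Real.sqrt x) := mul_le_mul hLL h2e (by positivity) (by positivity)
      _ ≤ (x : ℝ) ^ (1 / 250 : ℝ) * ((x : ℝ) ^ (3 / 500 : ℝ) * (x : ℝ) ^ (1 / 2 : ℝ)) := by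
          rw [hsqrt]
          exact mul_le_mul hR4 (mul_le_mul_of_nonneg_right h7 (by positivity)) (by positivity)
            (by positivity)
      _ = (x : ℝ) ^ (51 / 100 : ℝ) := by
          rw [← Real.rpow_add hx0, ← Real.rpow_add hx0]; norm_num
  -- residues: `(L₁ Δ + 1)² ≤ R⁴ (Δ+1)² ≤ x^{1/250} x^{1/2} ≤ x` for `L₁ < R²`
  have hΔ2 : ((Δ : ℝ) + 1) ^ 2 ≤ (x : ℝ) ^ (1 / 2 : ℝ) := by
    rw [← hsqrt]
    have h1 : ((Δ : ℝ) + 1) ^ 2 = Real.sqrt ((((Δ : ℝ) + 1) ^ 2) ^ 2) :=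
      (Real.sqrt_sq (by positivity)).symm
    rw [h1]
    refine Real.sqrt_le_sqrt ?_
    calc (((Δ : ℝ) + 1) ^ 2) ^ 2 = ((Δ : ℝ) + 1) ^ 4 := by ring
      _ ≤ (x : ℝ) := hxΔ
  have hgcdR : ((R ^ 2 * (Δ : ℝ)) + 1) ^ 2 ≤ x := by
    have hΔ0 : (0 : ℝ) ≤ Δ := Nat.cast_nonneg _
    have hR21 : 1 ≤ R ^ 2 := one_le_pow₀ hR1.le
    calc ((R ^ 2 * (Δ : ℝ)) + 1) ^ 2 ≤ (R ^ 2 * ((Δ : ℝ) + 1)) ^ 2 := by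
          apply pow_le_pow_left₀ (by positivity)
          rw [mul_add, mul_one]
          linarith [hR21]
      _ = R ^ 4 * ((Δ : ℝ) + 1) ^ 2 := by ring
      _ ≤ (x : ℝ) ^ (1 / 250 : ℝ) * (x : ℝ) ^ (1 / 2 : ℝ) :=
          mul_le_mul hR4 hΔ2 (by positivity) (by positivity)
      _ = (x : ℝ) ^ (1 / 250 + 1 / 2 : ℝ) := by rw [← Real.rpow_add hx0]
      _ ≤ (x : ℝ) ^ (1 : ℝ) := Real.rpow_le_rpow_of_exponent_le hx1r (by norm_num)
      _ = x := Real.rpow_one _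
  have hgcd : ∀ L₁ : ℕ, (L₁ : ℝ) < R ^ 2 → ((L₁ : ℝ) * (Δ : ℝ) + 1) ^ 2 ≤ x := by
    intro L₁ hL₁
    have hΔ0 : (0 : ℝ) ≤ Δ := Nat.cast_nonneg _
    have hL₁0 : (0 : ℝ) ≤ L₁ := Nat.cast_nonneg _
    refine le_trans ?_ hgcdR
    apply pow_le_pow_left₀ (by positivity)
    linarith [mul_le_mul_of_nonneg_right hL₁.le hΔ0]
  -- the logarithms
  have hlogx : 1 + Real.log x ≤ K₀ * (x : ℝ) ^ ε := one_add_log_le_mul_rpow' hx1r hε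
  have hlog0 : 0 ≤ Real.log (x : ℝ) := Real.log_nonneg hx1r
  have hKx1 : 1 ≤ K₀ * (x : ℝ) ^ ε := by linarith
  set W : ℝ := 2 * Bφ + B₁ * Real.log ((x : ℝ) + h₂) with hW
  have hWle : W ≤ (2 * Bφ + B₁) * K₀ * (x : ℝ) ^ ε := by
    have h1 : Real.log ((x : ℝ) + h₂) ≤ 1 + Real.log x := by
      have hl2 : Real.log 2 < 0.6931471808 := Real.log_two_lt_d9
      calc Real.log ((x : ℝ) + h₂) ≤ Real.log (2 * x) :=
            Real.log_le_log (by linarith) (by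
              have : (h₂ : ℝ) ≤ x := by exact_mod_cast hh₂
              linarith)
        _ = Real.log 2 + Real.log x := Real.log_mul (by norm_num) hx0.ne'
        _ ≤ 1 + Real.log x := by linarith
    rw [hW]
    have h2 : B₁ * Real.log ((x : ℝ) + h₂) ≤ B₁ * (K₀ * (x : ℝ) ^ ε) :=
      mul_le_mul_of_nonneg_left (h1.trans hlogx) hB₁0
    have h3 : 2 * Bφ ≤ 2 * Bφ * (K₀ * (x : ℝ) ^ ε) := le_mul_of_one_le_right (by positivity) hKx1
    calc 2 * Bφ + B₁ * Real.log ((x : ℝ) + h₂) ≤ 2 * Bφ * (K₀ * (x : ℝ) ^ ε) + B₁ * (K₀ * (x : ℝ) ^ ε) :=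
          add_le_add h3 h2
      _ = (2 * Bφ + B₁) * K₀ * (x : ℝ) ^ ε := by ring
  set Lg : ℝ := 1 + Real.log (2 * Real.exp 1 * Real.sqrt x + 1) with hLg
  have hLgle : Lg ≤ 3 * K₀ * (x : ℝ) ^ ε := by
    have h1 : Real.log (2 * Real.exp 1 * Real.sqrt x + 1) ≤ 2 + Real.log x := by
      have hsx : Real.sqrt x ≤ x := by
        rw [hsqrt]
        calc (x : ℝ) ^ (1 / 2 : ℝ) ≤ (x : ℝ) ^ (1 : ℝ) :=
              Real.rpow_le_rpow_of_exponent_le hx1r (by norm_num)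
          _ = x := Real.rpow_one _
      calc Real.log (2 * Real.exp 1 * Real.sqrt x + 1) ≤ Real.log (7 * x) :=
            Real.log_le_log (by positivity)
              (h2e.trans (mul_le_mul_of_nonneg_left hsx (by norm_num)))
        _ = Real.log 7 + Real.log x := Real.log_mul (by norm_num) hx0.ne'
        _ ≤ 2 + Real.log x := by linarith [log_seven_le_two]
    rw [hLg]
    linarith
  have hW0 : 0 ≤ W := by
    rw [hW]
    have : 0 ≤ Real.log ((x : ℝ) + h₂) := Real.log_nonneg (by linarith)
    positivity
  have hLg0 : 0 ≤ Lg := by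
    rw [hLg]
    have : 0 ≤ Real.log (2 * Real.exp 1 * Real.sqrt x + 1) :=
      Real.log_nonneg (le_add_of_nonneg_left (by positivity))
    linarith
  -- the sum is `S(u)` with `F = (χ∗log)♭`
  set F : ℕ → ℝ := fun N => flatLog χ φ ψ (Real.log x) (ε₀ / 20 * Real.log x + 2 * Real.log q) N
    with hFdef
  have hS : ∑ n ∈ Icc 1 x, vonMangoldtSiegelFlat χ φ ψ (Real.log x)
      (ε₀ / 20 * Real.log x + 2 * Real.log q) R (n + h₁) *
      (hypK χ φ u (n + h₂) * selbergSieve ψ R (n + h₂)) = crossS χ φ ψ F R h₁ h₂ x u := by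
    simp only [crossS, vonMangoldtSiegelFlat, hFdef]
  rw [hS]
  -- `|S(u)| ≤ R⁴ B_ψ⁴ · T*`
  set Tstar : ℝ := C₇ * (x : ℝ) ^ (1 - c₇) * ((R ^ 2 * (Δ : ℝ)) + 1) ^ 2 * W * Lg with hTstar
  have hT0 : 0 ≤ Tstar := by positivity
  have hT : ∀ L₁ L₂ : ℕ, 1 ≤ L₁ → (L₁ : ℝ) < R ^ 2 → 1 ≤ L₂ → (L₂ : ℝ) < R ^ 2 →
      (|crossT χ φ F h₁ h₂ L₁ L₂ x u| ≤ Tstar) := by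
    intro L₁ L₂ hL₁ hL₁R hL₂ hL₂R
    have hb := abs_crossT_le χ hφ hBφ hB₁ F hx1 hY hF hne hh₁ hh₂ hL₁ hL₂ (hQ L₁ L₂ hL₁R hL₂R)
      (hgcd L₁ hL₁R) u
    refine hb.trans ?_
    rw [hTstar]
    have hΔ0 : (0 : ℝ) ≤ Δ := Nat.cast_nonneg _
    have hL₁0 : (0 : ℝ) ≤ L₁ := Nat.cast_nonneg _
    have h1 : ((L₁ : ℝ) * (Δ : ℝ) + 1) ^ 2 ≤ ((R ^ 2 * (Δ : ℝ)) + 1) ^ 2 := by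
      apply pow_le_pow_left₀ (by positivity)
      linarith [mul_le_mul_of_nonneg_right hL₁R.le hΔ0]
    show _ ≤ C₇ * (x : ℝ) ^ (1 - c₇) * ((R ^ 2 * (Δ : ℝ)) + 1) ^ 2 *
      (2 * Bφ + B₁ * Real.log ((x : ℝ) + h₂)) * (1 + Real.log (2 * Real.exp 1 * Real.sqrt x + 1))
    exact mul_le_mul (mul_le_mul (mul_le_mul_of_nonneg_left h1 hY) le_rfl hW0 (by positivity))
      le_rfl hLg0 (by positivity)
  have hmain := abs_crossS_le χ φ hψ F hR1 hBψ h₁ h₂ x u hT0 hT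
  refine hmain.trans ?_
  -- absorbing `R⁸` and the logarithms
  have hΔ0 : (0 : ℝ) ≤ Δ := Nat.cast_nonneg _
  have hR21 : 1 ≤ R ^ 2 := one_le_pow₀ hR1.le
  have h1 : ((R ^ 2 * (Δ : ℝ)) + 1) ^ 2 ≤ R ^ 4 * ((Δ : ℝ) + 1) ^ 2 := by
    calc ((R ^ 2 * (Δ : ℝ)) + 1) ^ 2 ≤ (R ^ 2 * ((Δ : ℝ) + 1)) ^ 2 := by
          apply pow_le_pow_left₀ (by positivity)
          rw [mul_add, mul_one]
          linarith [hR21]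
      _ = R ^ 4 * ((Δ : ℝ) + 1) ^ 2 := by ring
  have hpow : (x : ℝ) ^ (c₇ / 2) * ((x : ℝ) ^ (1 - c₇) * (x : ℝ) ^ ε * (x : ℝ) ^ ε) =
      (x : ℝ) ^ (1 - c₇ / 4) := by
    rw [← Real.rpow_add hx0, ← Real.rpow_add hx0, ← Real.rpow_add hx0]
    congr 1
    rw [hεdef]; ring
  have hexp : (x : ℝ) ^ (1 - c₇ / 4) ≤ (x : ℝ) ^ (1 - c) :=
    Real.rpow_le_rpow_of_exponent_le hx1r (by linarith)
  calc R ^ 4 * Bψ ^ 4 * Tstar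
      = R ^ 4 * Bψ ^ 4 * (C₇ * (x : ℝ) ^ (1 - c₇) * ((R ^ 2 * (Δ : ℝ)) + 1) ^ 2 * W * Lg) := by
        rw [hTstar]
    _ ≤ R ^ 4 * Bψ ^ 4 * (C₇ * (x : ℝ) ^ (1 - c₇) * (R ^ 4 * ((Δ : ℝ) + 1) ^ 2) *
          ((2 * Bφ + B₁) * K₀ * (x : ℝ) ^ ε) * (3 * K₀ * (x : ℝ) ^ ε)) := by
        gcongr
    _ = Bψ ^ 4 * C₇ * ((Δ : ℝ) + 1) ^ 2 * ((2 * Bφ + B₁) * K₀) * (3 * K₀) *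
          (R ^ 8 * ((x : ℝ) ^ (1 - c₇) * (x : ℝ) ^ ε * (x : ℝ) ^ ε)) := by ring
    _ ≤ Bψ ^ 4 * C₇ * ((Δ : ℝ) + 1) ^ 2 * ((2 * Bφ + B₁) * K₀) * (3 * K₀) *
          ((x : ℝ) ^ (c₇ / 2) * ((x : ℝ) ^ (1 - c₇) * (x : ℝ) ^ ε * (x : ℝ) ^ ε)) := by
        gcongr
    _ = C * (x : ℝ) ^ (1 - c₇ / 4) := by rw [hpow, hCdef]
    _ ≤ C * (x : ℝ) ^ (1 - c) := mul_le_mul_of_nonneg_left hexp hC0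

end TaoTeravainen

end Literature.Barriers.Parity
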